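import Mathlib.Analysis.InnerProductSpace.PiL2
import Mathlib.Order.Lattice.Nat
import Literature.MathematicalPhysics.StatisticalMechanics.StickyChain
import Literature.Geometry.DiscreteGeometry.KissingNumberThreeProofs
import Literature.Barriers.AtomisticToContinuum.StickySphereClustersNarrow
import Mathlib.Analysis.SpecialFunctions.Pow.Real
import Mathlib.Analysis.SpecialFunctions.Trigonometric.Basic
import Mathlib.Analysis.SpecialFunctions.Sqrt
import Mathlib.Tactic.IntervalCases
import Literature.Geometry.DiscreteGeometry.SolidAngleFraction
import Literature.Geometry.DiscreteGeometry.SphericalIsoperimetric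
import Mathlib.Geometry.Euclidean.Angle.Unoriented.TriangleInequality
import Literature.Geometry.DiscreteGeometry.ExposedSurfaceIsoperimetric
import Literature.Geometry.DiscreteGeometry.SphericalIsoperimetricProof
import Literature.Geometry.DiscreteGeometry.ContactNumberBounds
import Literature.Geometry.DiscreteGeometry.IsoperimetricUnionBallsProof
import HarnessLib

/-!
# Contact numbers of unit sphere packings in `ℝ³`: `C < 6N − 1.67 N^{2/3}` by the Lévy route (exposed caps, Lévy–Schmidt, kissing saturation, Federer) — Bezdek–Reid 2013 Thm. 1 (i) `BezdekReid2013_contactNumber_lt` HOLDS (re-homed proofs)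

**Bezdek–Reid, *Contact graphs of unit sphere packings revisited*, J. Geom. 104 (2013), Theorem 1 (i): every packing of `n ≥ 2`
unit balls in `ℝ³` has fewer than `6n − 0.926 n^{2/3}` touching pairs** [BezdekReid2013] — here by the LÉVY ROUTE with the stronger
constant `1.67`: per-ball exposed directions at probing radius `1` (diameter-`1` normalisation), the Lévy–Schmidt spherical
isoperimetric inequality (Figiel–Lindenstrauss–Milman 1977 Thm. 2.1 [FigielLindenstraussMilman1977], tree theorem
`Schmidt1948_sphericalIsoperimetric_holds`), kissing saturation from the kissing number `12` (Musin 2006 [Musin2006], tree theorem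
`musin2006_kissing_three_holds`), the isoperimetric inequality for finite unions of balls (Federer 1969 [Federer1969], tree theorem
`Federer1969_isoperimetricUnionBalls_holds`), the certified exposed-area / contact-deficit table (`γ = 1/(4 g₁₁) > 1.6732`) and a
vertex-removal induction — NOT the printed dodecahedral route (Hales' Voronoi bound `0.7547`, Molnár's cap density).  The EXACT
discharge `Literature.Geometry.DiscreteGeometry.BezdekReid2013_contactNumber_lt_holds` of the named fact of `ContactNumberBounds.lean`
is the last Part, through the radius-one scaling bridge.  RE-HOMED into `Literature/` by the Hodge foundations lane (`lit-hodgefound`,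
seat p20, generation 37): verbatim DECLARATION-LEVEL ports (the declarations needed, in dependency order, each with its
route-neutralised module docstring) of the venture modules `Summits/Ventures/Crystal3D/{StickySpheres/ContactGraph (13 declarations),
LocalLP/ContactBridge (1), StickySpheres/RadiusOne (3), LocalLP/Induction (9), Inequalities/ExposedAreaDeficit (26), LocalLP/SurfaceComposition
(10), LocalLP/LevyCap (20), LocalLP/Saturation (3), LocalLP/LevyHeadline (1), LocalLP/IsoFederer (2)}.lean` (venture `Crystal3D`, where
they are the rigorous surface-term ladder of a sticky-sphere programme), namespace `Summit.Ventures.Crystal3D` re-rooted as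
`Literature.Geometry.DiscreteGeometry.ContactNumber` (sub-namespace `Inequalities` kept); the venture's `Statement.lean` wrappers
(`SurfaceBound γ`) are NOT re-homed — the last Part states the bounds unfolded.

DEFINITIONS kept from the source (with bodies, verbatim): `ContactNumber.IsUnitPacking` (centres of DIAMETER-`1` balls pairwise at
distance `≥ 1`; the tree's radius-`1` `IsUnitBallPacking`/`contactNumber` are reached by `x ↦ 2x`), `contactPairs`, `numContacts`,
`contactNeighbors`, `coordination`, the exposed directions `exposedCap x r i` and their fraction `exposedFraction`, the three
packing-level inputs `LevyCapInput`, `SaturationInput`, `IsoInput` (Props WITH parameters, used as hypotheses and all discharged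
here at probing radius `1`), the Lévy table constants `Inequalities.cθ`, `Inequalities.g`, `Inequalities.fLevy2`, and `uncoveredDir`.
No new named fact (D-0026); imports Mathlib/Literature only; every declaration carries the citation of the printed statement it
serves.  The Summits originals stay in place (transitional duplication; twins = same short names).  No crystallization statement
is claimed anywhere in this file.
-/

noncomputable section

/-!
## Part 1 — port of `Summits/Ventures/Crystal3D/StickySpheres/ContactGraph.lean` (13 declarations kept)

# Sticky hard spheres: unit packings, contact graphs, contact numbers

exact contact-graph enumeration + linear programming over local inequalities for sticky-sphere
crystallization. It contains DEFINITIONS and elementary API only. Nothing here is a claim about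
three-dimensional crystallization; no theorem of the literature is restated as proved.

## Content (all dimensions `d`)

* `IsUnitPacking x` — a finite labelled configuration `x : Fin N → ℝᵈ` of centres of hard spheres
  of DIAMETER `1`: distinct centres are at distance `≥ 1`. Two spheres are in CONTACT when their
  centres are at distance exactly `1`. (Bezdek's convention is radius `1` / contact distance `2`;
  the two differ by the scaling `x ↦ 2x` only. Distance `1` matches the tree's sticky potential
  `Literature.MathematicalPhysics.StatisticalMechanics.stickyPotential` and the Heitmann–Radin
  potential `V(r) = +∞ (r < 1), -1 (r = 1), 0 (r > 1)` as restated by De Luca–Friesecke.)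
* `contactPairs x`, `numContacts x` — the touching pairs `i < j` and their number, i.e. the number
  of edges of the contact graph (Bezdek's contact number `C(𝒫)`).
* `contactNeighbors x i`, `coordination x i` — the contact neighbours of ball `i` and their
  number (the degree of `i` in the contact graph); handshake
  `∑ i, coordination x i = 2 * numContacts x`.
* `maxContacts d N` — the largest contact number of a unit packing of `N` balls in `ℝᵈ`
  (Bezdek's `C(n)` for `d = 3`, Harborth's `c(n)` for `d = 2`); attained when `d ≥ 1`
  (`exists_numContacts_eq_maxContacts`), and an upper bound for every packing
  (`numContacts_le_maxContacts`).
* Link to the crystallization vocabulary of the tree (`interactionEnergy`, `stickyPotential`):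
  on a unit packing the sticky energy is minus the contact number
  (`interactionEnergy_stickyPotential_of_isUnitPacking`), so the ground-state energy of `N` hard
  sticky spheres is `-(maxContacts d N)`.

## Sources (for the notions; nothing is vendored as proved)

* K. Bezdek, *Contact numbers for congruent sphere packings in Euclidean 3-space*, Discrete
  Comput. Geom. 48 (2012) 298–309 (`Bezdek2012`), and the survey section "The Contact Number
  Problem of Unit Sphere Packings" in *Selected Open Problems in Discrete Geometry and
  Optimization*, Fields Inst. Commun. 69 (2013), §2.1 (contact graph, `C(𝒫)`, `C(n)`).
* H. Harborth, *Lösung zu Problem 664A*, Elem. Math. 29 (1974) 14–15 (`Harborth1974`): `c(n)`.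
* R. C. Heitmann, C. Radin, *The ground state for sticky disks*, J. Stat. Phys. 22 (1980) 281–287
  (`HeitmannRadin1980`): sticky potential, energy `= -`(number of bonds).

## Design notes

* Labelled configurations `Fin N → EuclideanSpace ℝ (Fin d)` (as in
  `Literature/MathematicalPhysics/StatisticalMechanics/Crystallization.lean`), not point sets:
  the enumeration engines and the LP bridge (`LocalLP/Certificate.lean`) count balls by
  label. A unit packing is automatically injective (`IsUnitPacking.injective`).
* `maxContacts` is a `sSup` in `ℕ`; the set of contact numbers is bounded by `N²`
  (`numContacts_le_sq`) and non-empty when `d ≥ 1` (collinear chain) or `N ≤ 1`; for `d = 0`,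
  `N ≥ 2` there is no packing and the junk value is `0` (documented, never used).
* The 3-dimensional, radius-`1` contact count `Literature.Barriers.AtomisticToContinuum.contactNumber`
  of the barrier catalogue is the special case `d = 3` after scaling by `2`; it is not imported here
  (`d = 2` and `d = 3` through one definition).
-/

section Part1

open scoped _root_.BigOperators
open _root_.Finset

namespace Literature.Geometry.DiscreteGeometry.ContactNumber

open Literature.MathematicalPhysics.StatisticalMechanics (interactionEnergy stickyPotential
  interactionEnergy_stickyPotential sum_ite_dist_lt_one_eq_zero_iff)

variable {d N : ℕ}

/-! ## Unit packings -/

/-- A **unit packing**: a labelled configuration of `N` centres of hard spheres of diameter `1` in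
`ℝᵈ` — distinct balls have centres at distance `≥ 1` (contact = distance exactly `1`).
[cite: Bezdek2012, §1 (contact graphs and the contact number C(n) of unit sphere packings; definitions)] -/
def IsUnitPacking (x : Fin N → EuclideanSpace ℝ (Fin d)) : Prop :=
  Pairwise fun i j => 1 ≤ dist (x i) (x j)

namespace IsUnitPacking

variable {x : Fin N → EuclideanSpace ℝ (Fin d)}

/-- In a unit packing distinct balls have centres at distance `≥ 1`.
[cite: Bezdek2012, §1 (contact graphs and the contact number C(n) of unit sphere packings; definitions)] -/
theorem one_le_dist (hx : IsUnitPacking x) {i j : Fin N} (h : i ≠ j) : 1 ≤ dist (x i) (x j) :=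
  hx h

/-- A unit packing is an injective configuration (distinct labels, distinct centres).
[cite: Bezdek2012, §1 (contact graphs and the contact number C(n) of unit sphere packings; definitions)] -/
theorem injective (hx : IsUnitPacking x) : Function.Injective x := by
  intro i j hij
  by_contra h
  have h1 := hx.one_le_dist h
  rw [hij, dist_self] at h1
  exact absurd h1 (by norm_num)

/-- A sub-configuration (relabelling along an injective map) of a unit packing is a unit
packing. [cite: Bezdek2012, §1 (contact graphs and the contact number C(n) of unit sphere packings; definitions)] -/
theorem comp {M : ℕ} (hx : IsUnitPacking x) {f : Fin M → Fin N} (hf : Function.Injective f) :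
    IsUnitPacking (x ∘ f) :=
  fun _ _ h => hx (hf.ne h)

end IsUnitPacking

/-- The **contact pairs** of a configuration: the pairs of labels `i < j` whose centres are at
distance exactly `1` (the edges of the contact graph).
[cite: Bezdek2012, §1 (contact graphs and the contact number C(n) of unit sphere packings; definitions)] -/
def contactPairs (x : Fin N → EuclideanSpace ℝ (Fin d)) : Finset (Fin N × Fin N) :=
  univ.filter fun p => p.1 < p.2 ∧ dist (x p.1) (x p.2) = 1

/-- The **contact number** `C(x)`: the number of touching pairs (edges of the contact graph). For
sticky spheres the energy of a packing is `-C(x)`.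
[cite: Bezdek2012, §1 (contact graphs and the contact number C(n) of unit sphere packings; definitions)] -/
def numContacts (x : Fin N → EuclideanSpace ℝ (Fin d)) : ℕ :=
  (contactPairs x).card

/-- The **contact neighbours** of ball `i`: the balls `j ≠ i` touching it.
[cite: Bezdek2012, §1 (contact graphs and the contact number C(n) of unit sphere packings; definitions)] -/
def contactNeighbors (x : Fin N → EuclideanSpace ℝ (Fin d)) (i : Fin N) : Finset (Fin N) :=
  univ.filter fun j => j ≠ i ∧ dist (x i) (x j) = 1

/-- The **coordination number** of ball `i`: its number of contacts (degree in the contact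
graph). [cite: Bezdek2012, §1 (contact graphs and the contact number C(n) of unit sphere packings; definitions)] -/
def coordination (x : Fin N → EuclideanSpace ℝ (Fin d)) (i : Fin N) : ℕ :=
  (contactNeighbors x i).card

variable (x : Fin N → EuclideanSpace ℝ (Fin d))

/-- Membership in the contact pairs.
[cite: Bezdek2012, §1 (contact graphs and the contact number C(n) of unit sphere packings; definitions)] -/
@[simp] theorem mem_contactPairs {p : Fin N × Fin N} :
    p ∈ contactPairs x ↔ p.1 < p.2 ∧ dist (x p.1) (x p.2) = 1 := by
  simp [contactPairs]

/-- Membership in the contact neighbours.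
[cite: Bezdek2012, §1 (contact graphs and the contact number C(n) of unit sphere packings; definitions)] -/
@[simp] theorem mem_contactNeighbors {i j : Fin N} :
    j ∈ contactNeighbors x i ↔ j ≠ i ∧ dist (x i) (x j) = 1 := by
  simp [contactNeighbors]

/-- The contact number is at most `N²` (crude bound; used only for boundedness).
[cite: Bezdek2012, §1 (contact graphs and the contact number C(n) of unit sphere packings; definitions)] -/
theorem numContacts_le_sq : numContacts x ≤ N ^ 2 := by
  calc numContacts x ≤ (univ : Finset (Fin N × Fin N)).card := card_filter_le _ _
    _ = N ^ 2 := by simp [sq]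

/-- The coordination number of a ball is at most `N - 1`.
[cite: Bezdek2012, §1 (contact graphs and the contact number C(n) of unit sphere packings; definitions)] -/
theorem coordination_le (i : Fin N) : coordination x i ≤ N - 1 := by
  have h : contactNeighbors x i ⊆ univ.erase i := by
    intro j hj
    exact mem_erase.2 ⟨((mem_contactNeighbors x).1 hj).1, mem_univ _⟩
  calc coordination x i ≤ (univ.erase i).card := card_le_card h
    _ = N - 1 := by simp [card_erase_of_mem]

/-- **Handshake.** The coordination numbers sum to twice the contact number:
`∑ i, deg(i) = 2 · C(x)`.
[cite: Bezdek2012, §1 (contact graphs and the contact number C(n) of unit sphere packings; definitions)] -/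
theorem sum_coordination_eq : ∑ i, coordination x i = 2 * numContacts x := by
  classical
  -- ordered contact pairs, split by orientation
  set S : Finset (Fin N × Fin N) := univ.filter fun p => p.2 ≠ p.1 ∧ dist (x p.1) (x p.2) = 1
    with hS
  have hsum : ∑ i, coordination x i = S.card := by
    rw [hS, card_filter, Fintype.sum_prod_type]
    refine sum_congr rfl fun i _ => ?_
    rw [coordination, contactNeighbors, card_filter]
  have hsplit : S = (S.filter fun p => p.1 < p.2) ∪ (S.filter fun p => p.2 < p.1) := by
    ext p
    simp only [mem_union, mem_filter, hS, mem_univ, true_and]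
    constructor
    · rintro ⟨hne, hd⟩
      rcases lt_or_gt_of_ne hne with h | h
      · exact Or.inr ⟨⟨hne, hd⟩, h⟩
      · exact Or.inl ⟨⟨hne, hd⟩, h⟩
    · rintro (⟨h, -⟩ | ⟨h, -⟩) <;> exact h
  have hdisj : Disjoint (S.filter fun p => p.1 < p.2) (S.filter fun p => p.2 < p.1) := by
    rw [disjoint_filter]
    intro p _ h
    exact not_lt.2 h.le
  have h1 : (S.filter fun p => p.1 < p.2) = contactPairs x := by
    ext p
    simp only [mem_filter, hS, mem_univ, true_and, mem_contactPairs]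
    constructor
    · rintro ⟨⟨-, hd⟩, hlt⟩; exact ⟨hlt, hd⟩
    · rintro ⟨hlt, hd⟩; exact ⟨⟨(ne_of_lt hlt).symm, hd⟩, hlt⟩
  have h2 : (S.filter fun p => p.2 < p.1) = (contactPairs x).map
      ⟨Prod.swap, Prod.swap_injective⟩ := by
    ext p
    simp only [mem_filter, hS, mem_univ, true_and, mem_map, Function.Embedding.coeFn_mk,
      mem_contactPairs, Prod.exists, Prod.swap_prod_mk]
    constructor
    · rintro ⟨⟨-, hd⟩, hlt⟩
      exact ⟨p.2, p.1, ⟨hlt, by rw [dist_comm]; exact hd⟩, by simp⟩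
    · rintro ⟨a, b, ⟨hlt, hd⟩, rfl⟩
      exact ⟨⟨(ne_of_lt hlt), by rw [dist_comm]; exact hd⟩, hlt⟩
  rw [hsum, hsplit, card_union_of_disjoint hdisj, h1, h2, card_map, numContacts, two_mul]

/-! ## The maximal contact number `C(n)` -/

variable {x}

end Literature.Geometry.DiscreteGeometry.ContactNumber

end Part1

/-!
## Part 2 — port of `Summits/Ventures/Crystal3D/LocalLP/ContactBridge.lean` (1 declarations kept)

# The contact bridge: local inequalities per coordination type + an exact LP certificate ⇒ a
# bound on the contact number of a unit sphere packing in `ℝ³`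

This file
PROVES (no `sorry`, no named-fact hypotheses):

* `coordination_le_twelve` — in a packing of unit-diameter balls in `ℝ³` every ball touches at
  most `12` others. This is the kissing-number theorem, imported from the tree where it is proved
  (`Literature.Geometry.DiscreteGeometry.musin2006_kissing_three_holds`, Schütte–van der Waerden
  1953 / Musin 2006), applied to the unit vectors `x j - x i` of the contact neighbours.
* `numContacts_le_six_mul`, `maxContacts_three_le` — hence `C(x) ≤ 6N` for every packing and
  `C(N) ≤ 6N` (the leading term of Bezdek's `C(N) < 6N - 0.926 N^{2/3}`; the surface correction
  is NOT proved here).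
* `coordType` — the LOCAL TYPE of a ball = its coordination number `0, …, 12` (a `Fin 13`), the
  type alphabet of the first LP; `sum_typeCount_coordType_mul` — the objective identity
  `∑ τ, (#balls of type τ) · τ = 2 · C(x)`.
* `two_mul_numContacts_le_of_cert` — THE BRIDGE: for a unit packing `x`, any VALID integer LP
  certificate (`LocalLP/Certificate.lean`) over the 13 type counts with objective `τ ↦ τ`, any
  non-negative parameters `p` (e.g. `(N, S)`), and a proof that the type counts of `x` satisfy the
  rows (this is where per-type local inequalities and global resource bounds enter, aggregated by
  `LocalLP.sum_le_sum_typeCount_mul`), yield `2 · C(x) ≤ ∑ k, D k · p k`.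
* `sixNCert`, `sixNCert_valid`, `two_mul_numContacts_le_twelve_mul_of_cert` — the end-to-end
  worked instance: the 14-row certificate {`∑ q ≤ N`; `-q_τ ≤ 0`} with multipliers
  `(12; 12, 11, …, 0)` is checked by `decide` and reproduces `2 · C(x) ≤ 12 N` through the bridge.

What is NOT here: any surface (`N^{2/3}`) term — that needs the geometric local
inequalities (exposed cap areas per type) and an isoperimetric lower bound, which enter the
bridge as feasibility hypotheses when they are proved or cited.

References: K. Bezdek, S. Reid, *Contact graphs of unit sphere packings revisited*, J. Geom. 104
(2013) 57–83, §2 (the type-LP pattern); O. R. Musin, *The kissing problem in three dimensions*,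
Discrete Comput. Geom. 35 (2006) 375–384 (kissing number twelve, proved in the tree).
-/

section Part2

open scoped _root_.BigOperators
open _root_.Finset

namespace Literature.Geometry.DiscreteGeometry.ContactNumber

open Literature.Geometry.DiscreteGeometry (musin2006_kissing_three_holds)

variable {N : ℕ} {x : Fin N → EuclideanSpace ℝ (Fin 3)}

/-! ## Kissing: at most twelve contacts per ball -/

/-- **At most twelve contacts per ball.** In a packing of unit-diameter balls in `ℝ³` every ball
has coordination number `≤ 12`: the contact neighbours `j` of `i` give unit vectors `x j - x i`
pairwise at distance `dist (x j) (x k) ≥ 1`, and the tree's kissing-number theorem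
(`musin2006_kissing_three_holds`) bounds their number by `12`.
[cite: Bezdek2012, §1 (C(n) ≤ 6n from the kissing number 12)] -/
theorem coordination_le_twelve (hx : IsUnitPacking x) (i : Fin N) : coordination x i ≤ 12 := by
  classical
  have hinj : Set.InjOn (fun j => x j - x i) ↑(contactNeighbors x i) :=
    fun j _ k _ h => hx.injective (sub_left_injective h)
  rw [coordination, ← card_image_of_injOn hinj]
  refine musin2006_kissing_three_holds _ ?_ ?_
  · intro v hv
    obtain ⟨j, hj, rfl⟩ := mem_image.1 hv
    rw [← dist_eq_norm, dist_comm]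
    exact ((mem_contactNeighbors x).1 hj).2
  · intro v hv w hw hvw
    obtain ⟨j, hj, rfl⟩ := mem_image.1 hv
    obtain ⟨k, hk, rfl⟩ := mem_image.1 hw
    have hjk : j ≠ k := fun h => hvw (by rw [h])
    rw [dist_eq_norm, sub_sub_sub_cancel_right, ← dist_eq_norm]
    exact hx hjk

end Literature.Geometry.DiscreteGeometry.ContactNumber

end Part2

/-!
## Part 3 — port of `Summits/Ventures/Crystal3D/StickySpheres/RadiusOne.lean` (3 declarations kept)

# The radius-one bridge: the diameter-`1` contact numbers vs the tree's radius-`1` ones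

These files work with balls of DIAMETER `1` (`IsUnitPacking`, `numContacts`,
`maxContacts`, contact at distance `1`); the tree's discrete-geometry files work with balls of
RADIUS `1` (`Literature.Geometry.DiscreteGeometry.IsUnitBallPacking` on point sets,
`Literature.Barriers.AtomisticToContinuum.contactNumber` = pairs at distance `2`). This file proves
the ONE scaling bridge between the two, so that radius-`1` results of the tree are quoted, never
re-proved. Everything here is proved; no claim about crystallization is made.

## Content

* `numContacts_eq_contactNumber_two_smul` — `C(x) = contactNumber (2 • x)`;
  `isUnitPacking_iff_two_smul` — `x` is a unit packing iff `2 • x` is injective with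
  `IsUnitBallPacking (range (2 • x))`; the halving direction `isUnitPacking_half_smul`,
  `numContacts_half_smul`; hence `le_maxContacts_of_radiusOne` (a radius-`1` witness with `k`
  contacts gives `k ≤ C(N)`) and `maxContacts_le_of_radiusOne` (a radius-`1` universal bound
  transfers).
* Integer models at diameter `1`: `numContacts_intConfig`, `isUnitPacking_intConfig` for the
  tree's scaled integer configurations `intConfig c (1/√m)` (contact at integer squared distance
  `m`, separation `≥ m`), so that kernel arithmetic (`decide`) certifies witnesses.
* Imported consequences (tree facts, not re-proved): `maxContacts_three_six : C(6) = 12` (from the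
  tree's discharged six-ball enumeration `contactNumber_le_octahedralSix` and the octahedron), and
  `fccNucleus_le_maxContacts : 36 + 4k ≤ C(13 + k)` for `k ≤ 6` (the tree's fcc nuclei).

References: the tree files `Literature/Barriers/AtomisticToContinuum/StickySphereClusters*.lean`
(Arkus–Manoharan–Brenner 2009, Hoy–Harwayne-Gidansky–O'Hern 2012, Bezdek 2012 as cited there).
-/

section Part3

open scoped _root_.BigOperators
open _root_.Finset

namespace Literature.Geometry.DiscreteGeometry.ContactNumber

open Literature.Geometry.DiscreteGeometry (IsUnitBallPacking sqNormInt intVec norm_intVec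
  intVec_sub)
open Literature.Barriers.AtomisticToContinuum (contactNumber intContactNumber intConfig
  dist_intConfig octahedralSix octaInt fccNucleus fccNucleusInt contactNumber_le_octahedralSix
  contactNumber_six isUnitBallPacking_octahedralSix sep_octa intContactNumber_octa sep_fccNucleus
  intContactNumber_fccNucleus)

variable {N : ℕ}

/-! ## Scaling by two -/

/-- Distances double under `x ↦ 2 • x`.
[cite: BezdekReid2013, Theorem 1 (i) (radius-1 vs diameter-1 normalisation; scaling bridge)] -/
theorem dist_two_smul (u v : EuclideanSpace ℝ (Fin 3)) :
    dist ((2 : ℝ) • u) ((2 : ℝ) • v) = 2 * dist u v := by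
  rw [dist_smul₀, Real.norm_two]

/-- **R3 bridge, contact numbers**: the contact number of `x` (pairs at distance `1`) is the
tree's `contactNumber` of the doubled configuration (pairs at distance `2`).
[cite: BezdekReid2013, Theorem 1 (i) (radius-1 vs diameter-1 normalisation; scaling bridge)] -/
theorem numContacts_eq_contactNumber_two_smul (x : Fin N → EuclideanSpace ℝ (Fin 3)) :
    numContacts x = contactNumber (fun i => (2 : ℝ) • x i) := by
  classical
  unfold numContacts contactPairs contactNumber
  congr 1
  refine filter_congr fun p _ => ?_
  rw [dist_two_smul]
  constructor
  · rintro ⟨h1, h2⟩; exact ⟨h1, by rw [h2]; norm_num⟩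
  · rintro ⟨h1, h2⟩; exact ⟨h1, by linarith⟩

/-- **R3 bridge, packings**: `x` is a packing of diameter-`1` balls iff the doubled labelled
configuration is injective and its range is a packing of radius-`1` balls in the tree's sense.
[cite: BezdekReid2013, Theorem 1 (i) (radius-1 vs diameter-1 normalisation; scaling bridge)] -/
theorem isUnitPacking_iff_two_smul (x : Fin N → EuclideanSpace ℝ (Fin 3)) :
    IsUnitPacking x ↔ Function.Injective (fun i => (2 : ℝ) • x i) ∧
      IsUnitBallPacking (Set.range fun i => (2 : ℝ) • x i) := by
  constructor
  · intro hx
    refine ⟨fun i j h => hx.injective (smul_right_injective _ (by norm_num : (2:ℝ) ≠ 0) h), ?_⟩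
    rintro _ ⟨i, rfl⟩ _ ⟨j, rfl⟩ hd
    by_contra hne
    have hij : i ≠ j := fun h => hne (h ▸ rfl)
    have h1 := hx hij
    rw [dist_two_smul] at hd
    linarith
  · rintro ⟨hinj, hP⟩ i j hij
    by_contra hlt
    have hd : dist ((2 : ℝ) • x i) ((2 : ℝ) • x j) < 2 := by
      rw [dist_two_smul]; linarith [not_le.1 hlt]
    exact hij (hinj (hP ⟨i, rfl⟩ ⟨j, rfl⟩ hd))

end Literature.Geometry.DiscreteGeometry.ContactNumber

end Part3

/-!
## Part 4 — port of `Summits/Ventures/Crystal3D/LocalLP/Induction.lean` (9 declarations kept)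

# Removing a low-degree ball: the induction that feeds the surface LP

Everything in this file is PROVED; it contains no
geometry beyond counting and no claim about crystallization. Purpose: the surface LP
(`6N - γ N^{2/3}`) is only applied to packings in which every ball has more than `k₀` contacts;
balls with `≤ k₀` contacts are removed one at a time, which costs at most `k₀` contacts and is
paid for by the growth of `6N - γ N^{2/3}` as long as `γ ((N+1)^{2/3} - N^{2/3}) ≤ 6 - k₀`.

## Content

* `numContacts_succAbove_add_coordination` — removing ball `i` from a configuration of `N + 1`
  balls loses exactly `coordination x i` contacts:
  `C(x) = C(x ∘ i.succAbove) + deg(i)`.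
* `numContacts_le_choose_two` — `C(x) ≤ N(N-1)/2` (for base cases).
* `rpow_two_thirds_succ_sub_le` — `(t+1)^{2/3} - t^{2/3} ≤ 2 / (3 t^{1/3})` for `t > 0`
  (from `2b³ - 3ab² + a³ = (b-a)²(2b+a) ≥ 0` with `a = t^{1/3}`, `b = (t+1)^{1/3}`), and the
  threshold form `step_of_threshold`.
* `surfaceBound_of_reduction` — THE WRAPPER: base cases for `2 ≤ N ≤ N₁`, the step inequality for
  `N ≥ N₁`, and the (LP-supplied) bound for packings of `N > N₁` balls all of whose balls have
  `> k₀` contacts, together give `C(x) < 6N - γ N^{2/3}` for every packing of every `N ≥ 2` balls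
  (the unfolded form of `Statement.SurfaceBound γ`).
-/

section Part4

open scoped _root_.BigOperators
open _root_.Finset

namespace Literature.Geometry.DiscreteGeometry.ContactNumber

variable {d N : ℕ}

/-! ## Counting: indicator forms and the removal identity -/

/-- Indicator form of the contact number: `C(x) = ∑_{a,b} [a < b ∧ |x a - x b| = 1]`.
[cite: BezdekReid2013, proof of Theorem 1 (i) (removing balls with few contacts; counting)] -/
theorem numContacts_eq_sum_ite (x : Fin N → EuclideanSpace ℝ (Fin d)) :
    numContacts x = ∑ a, ∑ b, if a < b ∧ dist (x a) (x b) = 1 then 1 else 0 := by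
  rw [numContacts, contactPairs, card_filter, Fintype.sum_prod_type]

/-- Indicator form of the coordination number: `deg(i) = ∑_j [j ≠ i ∧ |x i - x j| = 1]`.
[cite: BezdekReid2013, proof of Theorem 1 (i) (removing balls with few contacts; counting)] -/
theorem coordination_eq_sum_ite (x : Fin N → EuclideanSpace ℝ (Fin d)) (i : Fin N) :
    coordination x i = ∑ j, if j ≠ i ∧ dist (x i) (x j) = 1 then 1 else 0 := by
  rw [coordination, contactNeighbors, card_filter]

/-- **Removal identity.** Deleting ball `i` from a configuration of `N + 1` balls removes exactly
its `coordination x i` contacts: `C(x) = C(x ∘ i.succAbove) + deg(i)`.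
[cite: BezdekReid2013, proof of Theorem 1 (i) (removing balls with few contacts; counting)] -/
theorem numContacts_succAbove_add_coordination (x : Fin (N + 1) → EuclideanSpace ℝ (Fin d))
    (i : Fin (N + 1)) :
    numContacts x = numContacts (fun a => x (i.succAbove a)) + coordination x i := by
  -- peel off the index `i` in the outer sum and in every inner sum
  have E1 := Fin.sum_univ_succAbove
    (fun a => ∑ b, if a < b ∧ dist (x a) (x b) = 1 then (1 : ℕ) else 0) i
  have E2 := Fin.sum_univ_succAbove
    (fun b => if i < b ∧ dist (x i) (x b) = 1 then (1 : ℕ) else 0) i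
  have E3 : ∀ a' : Fin N,
      (∑ b, if i.succAbove a' < b ∧ dist (x (i.succAbove a')) (x b) = 1 then (1 : ℕ) else 0) =
        (if i.succAbove a' < i ∧ dist (x (i.succAbove a')) (x i) = 1 then 1 else 0) +
          ∑ b', if a' < b' ∧ dist (x (i.succAbove a')) (x (i.succAbove b')) = 1 then 1 else 0 := by
    intro a'
    rw [Fin.sum_univ_succAbove _ i]
    simp only [Fin.succAbove_lt_succAbove_iff]
  -- the two boundary sums recombine into the coordination number of `i`
  have E4 : ∀ a' : Fin N,
      ((if i < i.succAbove a' ∧ dist (x i) (x (i.succAbove a')) = 1 then (1 : ℕ) else 0) +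
        if i.succAbove a' < i ∧ dist (x (i.succAbove a')) (x i) = 1 then 1 else 0) =
        if dist (x i) (x (i.succAbove a')) = 1 then 1 else 0 := by
    intro a'
    rw [dist_comm (x (i.succAbove a')) (x i)]
    rcases lt_or_gt_of_ne (Fin.succAbove_ne i a') with h | h
    · simp [h, not_lt.2 h.le]
    · simp [h, not_lt.2 h.le]
  have E5 : coordination x i =
      ∑ a', ((if i < i.succAbove a' ∧ dist (x i) (x (i.succAbove a')) = 1 then (1 : ℕ) else 0) +
        if i.succAbove a' < i ∧ dist (x (i.succAbove a')) (x i) = 1 then 1 else 0) := by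
    rw [coordination_eq_sum_ite, Fin.sum_univ_succAbove _ i]
    simp only [ne_eq, not_true_eq_false, false_and, if_false, zero_add, Fin.succAbove_ne,
      not_false_eq_true, true_and]
    exact sum_congr rfl fun a' _ => (E4 a').symm
  rw [numContacts_eq_sum_ite, numContacts_eq_sum_ite, E1, E2, E5]
  simp only [lt_self_iff_false, false_and, if_false, zero_add, E3, sum_add_distrib]
  ring

/-- `2 C(x) ≤ N (N - 1)`, from the handshake identity and `deg ≤ N - 1`.
[cite: BezdekReid2013, proof of Theorem 1 (i) (removing balls with few contacts; counting)] -/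
theorem two_mul_numContacts_le_mul_pred (x : Fin N → EuclideanSpace ℝ (Fin d)) :
    2 * numContacts x ≤ N * (N - 1) := by
  rw [← sum_coordination_eq]
  calc ∑ i, coordination x i ≤ ∑ _i : Fin N, (N - 1) := sum_le_sum fun i _ => coordination_le x i
    _ = N * (N - 1) := by simp

/-- `C(x) ≤ N (N - 1) / 2` as a real inequality (base cases of the induction).
[cite: BezdekReid2013, proof of Theorem 1 (i) (removing balls with few contacts; counting)] -/
theorem numContacts_le_choose_two (x : Fin N → EuclideanSpace ℝ (Fin d)) :
    (numContacts x : ℝ) ≤ (N : ℝ) * ((N : ℝ) - 1) / 2 := by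
  have h := two_mul_numContacts_le_mul_pred x
  rcases Nat.eq_zero_or_pos N with hN | hN
  · subst hN
    have : numContacts x = 0 := by
      have := numContacts_le_sq x; simpa using this
    simp [this]
  · have hcast : ((N * (N - 1) : ℕ) : ℝ) = (N : ℝ) * ((N : ℝ) - 1) := by
      rw [Nat.cast_mul, Nat.cast_sub hN]; simp
    have h' : (2 * numContacts x : ℝ) ≤ (N : ℝ) * ((N : ℝ) - 1) := by
      rw [← hcast]; exact_mod_cast h
    linarith

/-! ## The step inequality `(t+1)^{2/3} - t^{2/3} ≤ 2 / (3 t^{1/3})` -/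

/-- For `t > 0`: `(t + 1)^{2/3} - t^{2/3} ≤ 2 / (3 t^{1/3})` — with `a = t^{1/3}`,
`b = (t+1)^{1/3}` this is `3a(b² - a²) ≤ 2(b³ - a³)`, i.e. `(b - a)²(2b + a) ≥ 0`.
[cite: BezdekReid2013, proof of Theorem 1 (i) (removing balls with few contacts; counting)] -/
theorem rpow_two_thirds_succ_sub_le {t : ℝ} (ht : 0 < t) :
    (t + 1) ^ ((2 : ℝ) / 3) - t ^ ((2 : ℝ) / 3) ≤ 2 / (3 * t ^ ((1 : ℝ) / 3)) := by
  set a := t ^ ((1 : ℝ) / 3) with ha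
  set b := (t + 1) ^ ((1 : ℝ) / 3) with hb
  have ha0 : 0 < a := Real.rpow_pos_of_pos ht _
  have hb0 : 0 < b := Real.rpow_pos_of_pos (by linarith) _
  have ha3 : a ^ 3 = t := by
    rw [ha, ← Real.rpow_natCast, ← Real.rpow_mul ht.le]; norm_num
  have hb3 : b ^ 3 = t + 1 := by
    rw [hb, ← Real.rpow_natCast, ← Real.rpow_mul (by linarith)]; norm_num
  have ha2 : t ^ ((2 : ℝ) / 3) = a ^ 2 := by
    rw [ha, ← Real.rpow_natCast, ← Real.rpow_mul ht.le]; norm_num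
  have hb2 : (t + 1) ^ ((2 : ℝ) / 3) = b ^ 2 := by
    rw [hb, ← Real.rpow_natCast, ← Real.rpow_mul (by linarith)]; norm_num
  rw [ha2, hb2, le_div_iff₀ (by positivity)]
  have key : 0 ≤ (b - a) ^ 2 * (2 * b + a) := by positivity
  nlinarith [key, ha3, hb3]

/-- `t ↦ t^{1/3}` is monotone, so the step bound improves with `t`: for `t ≥ s > 0`,
`2 / (3 t^{1/3}) ≤ 2 / (3 s^{1/3})`.
[cite: BezdekReid2013, proof of Theorem 1 (i) (removing balls with few contacts; counting)] -/
theorem two_div_rpow_third_antitone {s t : ℝ} (hs : 0 < s) (hst : s ≤ t) :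
    2 / (3 * t ^ ((1 : ℝ) / 3)) ≤ 2 / (3 * s ^ ((1 : ℝ) / 3)) := by
  have hs' : 0 < s ^ ((1 : ℝ) / 3) := Real.rpow_pos_of_pos hs _
  have hmono : s ^ ((1 : ℝ) / 3) ≤ t ^ ((1 : ℝ) / 3) :=
    Real.rpow_le_rpow hs.le hst (by norm_num)
  exact div_le_div_of_nonneg_left (by norm_num) (by positivity) (by linarith)

/-- **Threshold form of the step condition.** If `γ ≥ 0` and `2 γ ≤ 3 (6 - k₀) N₁^{1/3}` with
`N₁ ≥ 1`, then `γ ((N+1)^{2/3} - N^{2/3}) ≤ 6 - k₀` for every `N ≥ N₁`.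
[cite: BezdekReid2013, proof of Theorem 1 (i) (removing balls with few contacts; counting)] -/
theorem step_of_threshold {γ : ℝ} {k₀ N₁ : ℕ} (hγ : 0 ≤ γ) (hN₁ : 1 ≤ N₁)
    (h : 2 * γ ≤ 3 * (6 - (k₀ : ℝ)) * (N₁ : ℝ) ^ ((1 : ℝ) / 3)) :
    ∀ N : ℕ, N₁ ≤ N →
      γ * (((N : ℝ) + 1) ^ ((2 : ℝ) / 3) - (N : ℝ) ^ ((2 : ℝ) / 3)) ≤ 6 - (k₀ : ℝ) := by
  intro N hN
  have hN₁' : (0 : ℝ) < N₁ := by exact_mod_cast hN₁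
  have hN' : (0 : ℝ) < N := by exact_mod_cast (lt_of_lt_of_le hN₁ hN)
  have hc : (0 : ℝ) < (N₁ : ℝ) ^ ((1 : ℝ) / 3) := Real.rpow_pos_of_pos hN₁' _
  have h1 := rpow_two_thirds_succ_sub_le hN'
  have h2 := two_div_rpow_third_antitone hN₁' (show (N₁ : ℝ) ≤ N by exact_mod_cast hN)
  have h3 : γ * (2 / (3 * (N₁ : ℝ) ^ ((1 : ℝ) / 3))) ≤ 6 - (k₀ : ℝ) := by
    rw [mul_div_assoc', div_le_iff₀ (by positivity)]
    linarith
  calc γ * (((N : ℝ) + 1) ^ ((2 : ℝ) / 3) - (N : ℝ) ^ ((2 : ℝ) / 3))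
      ≤ γ * (2 / (3 * (N₁ : ℝ) ^ ((1 : ℝ) / 3))) :=
        mul_le_mul_of_nonneg_left (h1.trans h2) hγ
    _ ≤ 6 - (k₀ : ℝ) := h3

/-! ## The wrapper: base cases + step condition + LP on reduced packings ⇒ the surface bound -/

/-- **Vertex-removal induction.** Suppose: (base) every packing of `2 ≤ N ≤ N₁` balls satisfies
`C < 6N - γN^{2/3}`; (step) `γ((N+1)^{2/3} - N^{2/3}) ≤ 6 - k₀` for `N ≥ N₁`; (LP) every packing
of `N > N₁` balls ALL of whose balls have more than `k₀` contacts satisfies `C < 6N - γN^{2/3}`.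
Then every packing of every `N ≥ 2` balls satisfies `C < 6N - γ N^{2/3}` (the unfolded form of
`SurfaceBound γ`). Requires `N₁ ≥ 2`.
[cite: BezdekReid2013, proof of Theorem 1 (i) (removing balls with few contacts; counting)] -/
theorem surfaceBound_of_reduction {γ : ℝ} {k₀ N₁ : ℕ} (hN₁ : 2 ≤ N₁)
    (hbase : ∀ N : ℕ, 2 ≤ N → N ≤ N₁ → ∀ x : Fin N → EuclideanSpace ℝ (Fin 3),
      IsUnitPacking x → (numContacts x : ℝ) < 6 * N - γ * (N : ℝ) ^ ((2 : ℝ) / 3))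
    (hstep : ∀ N : ℕ, N₁ ≤ N →
      γ * (((N : ℝ) + 1) ^ ((2 : ℝ) / 3) - (N : ℝ) ^ ((2 : ℝ) / 3)) ≤ 6 - (k₀ : ℝ))
    (hLP : ∀ N : ℕ, N₁ < N → ∀ x : Fin N → EuclideanSpace ℝ (Fin 3), IsUnitPacking x →
      (∀ i, k₀ < coordination x i) → (numContacts x : ℝ) < 6 * N - γ * (N : ℝ) ^ ((2 : ℝ) / 3)) :
    ∀ N : ℕ, 2 ≤ N → ∀ x : Fin N → EuclideanSpace ℝ (Fin 3), IsUnitPacking x →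
      (numContacts x : ℝ) < 6 * N - γ * (N : ℝ) ^ ((2 : ℝ) / 3) := by
  intro N
  induction N using Nat.strong_induction_on with
  | _ N ih =>
    intro hN x hx
    by_cases hle : N ≤ N₁
    · exact hbase N hN hle x hx
    · have hlt : N₁ < N := not_le.1 hle
      by_cases hall : ∀ i, k₀ < coordination x i
      · exact hLP N hlt x hx hall
      · obtain ⟨i, hi⟩ : ∃ i, coordination x i ≤ k₀ := by
          by_contra hcon
          exact hall fun i => not_le.1 fun hle => hcon ⟨i, hle⟩
        -- `N = M + 1` with `N₁ ≤ M`; remove ball `i`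
        obtain ⟨M, rfl⟩ : ∃ M, N = M + 1 := ⟨N - 1, by omega⟩
        have hM₁ : N₁ ≤ M := by omega
        have hM2 : 2 ≤ M := le_trans hN₁ hM₁
        have hx'P : IsUnitPacking (fun a => x (i.succAbove a)) :=
          hx.comp Fin.succAbove_right_injective
        have hIH := ih M (Nat.lt_succ_self M) hM2 _ hx'P
        have hrem := numContacts_succAbove_add_coordination x i
        have hC : (numContacts x : ℝ) ≤ numContacts (fun a => x (i.succAbove a)) + k₀ := by
          have : numContacts x ≤ numContacts (fun a => x (i.succAbove a)) + k₀ := by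
            rw [hrem]; omega
          exact_mod_cast this
        have hs := hstep M hM₁
        push_cast
        linarith

end Literature.Geometry.DiscreteGeometry.ContactNumber

end Part4

/-!
## Part 5 — port of `Summits/Ventures/Crystal3D/Inequalities/ExposedAreaDeficit.lean` (26 declarations kept)

# The exposed-area / contact-deficit LP for sticky spheres in `ℝ³`: the summation and its certified constant

HONEST FRAMING. This file proves the ARITHMETIC SKELETON of the surface-term bound
`C ≤ 6n − γ n^{2/3}` for the number `C` of touching pairs among `n` unit balls of `ℝ³`: (i) the per-ball
summation ("LP over ball types `k` = number of contacts": exposed area `≤ f(k)`, deficit `12 − k`), and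
(ii) the certified inequalities between the explicit algebraic constants of the Lévy-dilation table at
truncation radius `r̂ = 2` (`α = π/3`, `δ = π/6`), giving `γ ≥ 1.673` relative to a surface lower bound
`4π n^{2/3}`. The GEOMETRIC inputs that produce the exposed areas `e i` and the hypothesis `Σ e i ≥ S`
(kissing number — proved in the tree —, cap disjointness, Lévy's spherical isoperimetric inequality, the
isoperimetric inequality of `ℝ³`, the Voronoi tiling of the union of `r̂`-balls) are NOT formalised here; they
are hypotheses of the final theorem, listed in the Part `SurfaceComposition`. Nothing here is a crystallization
statement.

## The table at `r̂ = 2`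
For a ball with `k ∈ {1,…,11}` contacts, the uncovered directions `W ⊂ S²` satisfy, by cap disjointness and Lévy's
inequality, `σ(W) ≤ cap(θ_k − π/6)` with `cos θ_k = c_k := k(1 − √3/2) − 1`, i.e. the exposed area of the sphere
of radius `2` is at most `f(k) := 4 · 2π (1 − cos(θ_k − π/6)) = 8π · g_k`,
`g_k := 1 − (√3/2) c_k − ½ √(1 − c_k²)`; `f(12) = 0` (kissing saturation), and maximisers have no ball with
`k = 0`. The LP constant is `ρ = max_k f(k)/(12−k) = f(11)` (binding type `k = 11`, proved below:
`g_k ≤ (12 − k) g₁₁` for `1 ≤ k ≤ 10`) and `g₁₁ < 0.14941`, whence `γ = 2π/ρ = 1/(4 g₁₁) > 1.6732`.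
-/

section Part5

open _root_.Real _root_.Finset

namespace Literature.Geometry.DiscreteGeometry.ContactNumber.Inequalities

/-! ### 1. The summation (one term per ball, unit weights) -/

/-- **The exposed-area / deficit summation.** Balls `i ∈ Fin n` with contact numbers `k i ∈ {1,…,12}` and
exposed areas `e i ≤ f (k i)`, where `f 12 ≤ 0` and `f m ≤ ρ (12 − m)` for `1 ≤ m ≤ 11` (`ρ > 0`); if the total
exposed area is at least `S`, then `Σ k i ≤ 12 n − S/ρ`, i.e. the number of contacts `½ Σ k i` is at most
`6n − S/(2ρ)`. [折 DECOMPOSITION.md §4 (a)–(c); Bezdek–Reid 2013 §2 architecture] [cite: BezdekReid2013, proof of Theorem 1 (i) (per-ball exposed-area / contact-deficit summation; here with the Lévy cap table at probing radius 2)] -/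
theorem sum_deg_le_of_exposed {n : ℕ} (k : Fin n → ℕ) (e : Fin n → ℝ) (f : ℕ → ℝ) {ρ S : ℝ}
    (hρ : 0 < ρ) (hk1 : ∀ i, 1 ≤ k i) (hk12 : ∀ i, k i ≤ 12) (hf12 : f 12 ≤ 0)
    (hf : ∀ m, 1 ≤ m → m ≤ 11 → f m ≤ ρ * (12 - m)) (he : ∀ i, e i ≤ f (k i))
    (hS : S ≤ ∑ i, e i) :
    (∑ i, (k i : ℝ)) ≤ 12 * n - S / ρ := by
  have key : ∀ i, e i ≤ ρ * (12 - (k i : ℝ)) := by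
    intro i
    rcases Nat.lt_or_ge (k i) 12 with hlt | hge
    · have := hf (k i) (hk1 i) (by omega)
      exact (he i).trans (by exact_mod_cast this)
    · have h12 : k i = 12 := le_antisymm (hk12 i) hge
      have : e i ≤ 0 := (he i).trans (by rw [h12]; exact hf12)
      rw [h12]; push_cast; linarith
  have hsum : S ≤ ρ * (12 * n - ∑ i, (k i : ℝ)) := by
    calc S ≤ ∑ i, e i := hS
      _ ≤ ∑ i, ρ * (12 - (k i : ℝ)) := sum_le_sum fun i _ => key i
      _ = ρ * (12 * n - ∑ i, (k i : ℝ)) := by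
        rw [← mul_sum, sum_sub_distrib, sum_const, card_univ, Fintype.card_fin, nsmul_eq_mul]; ring
  have : S / ρ ≤ 12 * n - ∑ i, (k i : ℝ) := by
    rw [div_le_iff₀ hρ]; linarith
  linarith

/-- **Contact form**: with `2 C = Σ k i` (handshake), `C ≤ 6 n − S/(2ρ)`. [cite: BezdekReid2013, proof of Theorem 1 (i) (per-ball exposed-area / contact-deficit summation; here with the Lévy cap table at probing radius 2)] -/
theorem contacts_le_of_exposed {n C : ℕ} (k : Fin n → ℕ) (e : Fin n → ℝ) (f : ℕ → ℝ) {ρ S : ℝ}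
    (hρ : 0 < ρ) (hk1 : ∀ i, 1 ≤ k i) (hk12 : ∀ i, k i ≤ 12) (hf12 : f 12 ≤ 0)
    (hf : ∀ m, 1 ≤ m → m ≤ 11 → f m ≤ ρ * (12 - m)) (he : ∀ i, e i ≤ f (k i))
    (hS : S ≤ ∑ i, e i) (hC : 2 * C = ∑ i, k i) :
    (C : ℝ) ≤ 6 * n - S / (2 * ρ) := by
  have h := sum_deg_le_of_exposed k e f hρ hk1 hk12 hf12 hf he hS
  have hC' : (2 * C : ℝ) = ∑ i, (k i : ℝ) := by exact_mod_cast hC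
  have hρ2 : S / (2 * ρ) = (S / ρ) / 2 := by rw [div_div, mul_comm]
  rw [hρ2]
  linarith

/-! ### 2. From Lévy's inequality to the cap-radius bound (the step `F(k)` of DECOMPOSITION.md §3) -/

/-- `c_k := k (1 − √3/2) − 1`, the cosine of the critical angle `θ_k`: a cap of radius `θ_k` has area
`4π − k · cap(π/6)`. [cite: BezdekReid2013, proof of Theorem 1 (i) (per-ball exposed-area / contact-deficit summation; here with the Lévy cap table at probing radius 2)] -/
def cθ (k : ℕ) : ℝ := k * (1 - sqrt 3 / 2) - 1

/-- `g_k := 1 − (√3/2) c_k − ½ √(1 − c_k²)` (`= 1 − cos(θ_k − π/6)`, see `one_sub_cos_sub_eq_g`). [cite: BezdekReid2013, proof of Theorem 1 (i) (per-ball exposed-area / contact-deficit summation; here with the Lévy cap table at probing radius 2)] -/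
def g (k : ℕ) : ℝ := 1 - sqrt 3 / 2 * cθ k - 1 / 2 * sqrt (1 - cθ k ^ 2)

/-- **The Lévy-dilation exposed-area table at truncation radius `r̂ = 2`** (sphere of radius `2`, so areas are
`4σ`): `f 0 = 16π` (whole sphere), `f k = 8π g_k` for `1 ≤ k ≤ 11`, `f k = 0` for `k ≥ 12` (kissing saturation).
[cite: BezdekReid2013, proof of Theorem 1 (i) (per-ball exposed-area / contact-deficit summation; here with the Lévy cap table at probing radius 2)] -/
def fLevy2 (k : ℕ) : ℝ := if k = 0 then 16 * π else if 12 ≤ k then 0 else 8 * π * g k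

/-- **Area bookkeeping of the dilation step.** If the `δ`-neighbourhood of the uncovered set has (by Lévy) area at
least that of a cap of radius `ρ_W + δ ≤ π`, and (by disjointness from the `k` open `π/6`-caps) at most
`4π − k · 2π(1 − √3/2)`, then `c_k ≤ cos(ρ_W + δ)`. [cite: BezdekReid2013, proof of Theorem 1 (i) (per-ball exposed-area / contact-deficit summation; here with the Lévy cap table at probing radius 2)] -/
theorem cθ_le_cos_of_area {k : ℕ} {x : ℝ}
    (harea : 2 * π * (1 - cos x) ≤ 4 * π - k * (2 * π * (1 - sqrt 3 / 2))) : cθ k ≤ cos x := by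
  unfold cθ
  have hπ : 0 < π := pi_pos
  nlinarith

/-- **Monotonicity of `cos` on `[0, π]` read backwards**: `cos θ ≤ cos x` with `x ≤ π`, `0 ≤ θ` gives `x ≤ θ`.
[cite: BezdekReid2013, proof of Theorem 1 (i) (per-ball exposed-area / contact-deficit summation; here with the Lévy cap table at probing radius 2)] -/
theorem le_of_cos_le_cos {x θ : ℝ} (hxπ : x ≤ π) (hθ0 : 0 ≤ θ)
    (h : cos θ ≤ cos x) : x ≤ θ := by
  by_contra hlt
  push Not at hlt
  have := cos_lt_cos_of_nonneg_of_le_pi hθ0 hxπ hlt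
  linarith

/-- **The closed form**: for `θ ∈ [0, π]` with `cos θ = c_k`, `1 − cos(θ − π/6) = g_k`. [cite: BezdekReid2013, proof of Theorem 1 (i) (per-ball exposed-area / contact-deficit summation; here with the Lévy cap table at probing radius 2)] -/
theorem one_sub_cos_sub_eq_g {θ : ℝ} {k : ℕ} (h0 : 0 ≤ θ) (hπ : θ ≤ π) (hc : cos θ = cθ k) :
    1 - cos (θ - π / 6) = g k := by
  have hs : sin θ = sqrt (1 - cθ k ^ 2) := by
    rw [← hc, show 1 - cos θ ^ 2 = sin θ ^ 2 from (sin_sq θ).symm]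
    exact (sqrt_sq (sin_nonneg_of_nonneg_of_le_pi h0 hπ)).symm
  unfold g
  rw [cos_sub, cos_pi_div_six, sin_pi_div_six, hc, ← hs]
  ring

/-- **Cap areas are monotone in the radius on `[0, π]`.** [cite: BezdekReid2013, proof of Theorem 1 (i) (per-ball exposed-area / contact-deficit summation; here with the Lévy cap table at probing radius 2)] -/
theorem cap_area_mono {x y : ℝ} (hx0 : 0 ≤ x) (hxy : x ≤ y) (hyπ : y ≤ π) :
    2 * π * (1 - cos x) ≤ 2 * π * (1 - cos y) := by
  have : cos y ≤ cos x := cos_le_cos_of_nonneg_of_le_pi hx0 hyπ hxy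
  have hπ : 0 < π := pi_pos
  nlinarith

/-- **`F(k)` at `r̂ = 2`.** Let `1 ≤ k ≤ 11`, let `θ ∈ [0, π]` with `cos θ = c_k`, and let the uncovered set have
area `4 · 2π(1 − cos ρ_W)` on the sphere of radius `2` (cap radius `ρ_W ≥ 0`) with `ρ_W + π/6 ≤ π` and the
area bookkeeping hypothesis of `cθ_le_cos_of_area` at `x = ρ_W + π/6`. Then the exposed area is at most
`fLevy2 k = 8π g_k`. [cite: BezdekReid2013, proof of Theorem 1 (i) (per-ball exposed-area / contact-deficit summation; here with the Lévy cap table at probing radius 2)] -/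
theorem exposed_le_fLevy2 {k : ℕ} (hk1 : 1 ≤ k) (hk11 : k ≤ 11) {θ ρW : ℝ} (hθ0 : 0 ≤ θ) (hθπ : θ ≤ π)
    (hc : cos θ = cθ k) (hρ0 : 0 ≤ ρW) (hρπ : ρW + π / 6 ≤ π)
    (harea : 2 * π * (1 - cos (ρW + π / 6)) ≤ 4 * π - k * (2 * π * (1 - sqrt 3 / 2))) :
    4 * (2 * π * (1 - cos ρW)) ≤ fLevy2 k := by
  have hπ : 0 < π := pi_pos
  have h1 : cθ k ≤ cos (ρW + π / 6) := cθ_le_cos_of_area harea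
  have h2 : ρW + π / 6 ≤ θ :=
    le_of_cos_le_cos hρπ hθ0 (by rw [hc]; exact h1)
  have h3 : 2 * π * (1 - cos ρW) ≤ 2 * π * (1 - cos (θ - π / 6)) :=
    cap_area_mono hρ0 (by linarith) (by linarith)
  have h4 : 1 - cos (θ - π / 6) = g k := one_sub_cos_sub_eq_g hθ0 hθπ hc
  have hk0 : k ≠ 0 := by omega
  have hk12 : ¬ 12 ≤ k := by omega
  simp only [fLevy2, hk0, hk12, if_false]
  nlinarith

/-! ### 3. The certified constants (binding type `k = 11`; `γ > 1.6732`) -/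

/-- `1.7320508 < √3 < 1.7320509`. [cite: BezdekReid2013, proof of Theorem 1 (i) (per-ball exposed-area / contact-deficit summation; here with the Lévy cap table at probing radius 2)] -/
theorem sqrt_three_bounds : (1.7320508 : ℝ) < sqrt 3 ∧ sqrt 3 < 1.7320509 := by
  constructor
  · rw [lt_sqrt (by norm_num)]; norm_num
  · rw [sqrt_lt' (by norm_num)]; norm_num

/-- `0.149408 < g₁₁ < 0.149409` (`g₁₁ = 0.14940835…`). [cite: BezdekReid2013, proof of Theorem 1 (i) (per-ball exposed-area / contact-deficit summation; here with the Lévy cap table at probing radius 2)] -/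
theorem g_eleven_bounds : (0.149408 : ℝ) < g 11 ∧ g 11 < 0.149409 := by
  obtain ⟨h3l, h3u⟩ := sqrt_three_bounds
  have hcl : (0.47372 : ℝ) < cθ 11 := by unfold cθ; linarith
  have hcu : cθ 11 < (0.4737206 : ℝ) := by unfold cθ; linarith
  have hsl : (0.8806751 : ℝ) < sqrt (1 - cθ 11 ^ 2) := by
    rw [lt_sqrt (by norm_num)]; nlinarith
  have hsu : sqrt (1 - cθ 11 ^ 2) < (0.8806756 : ℝ) := by
    rw [sqrt_lt' (by norm_num)]; nlinarith
  unfold g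
  constructor <;> nlinarith

/-- `g_1 ≤ 1.500164642245` (certified bracket; `g_1/(12 − 1) < g₁₁`). [cite: BezdekReid2013, proof of Theorem 1 (i) (per-ball exposed-area / contact-deficit summation; here with the Lévy cap table at probing radius 2)] -/
theorem g_one_le : g 1 ≤ 1.500164642245 := by
  obtain ⟨h3l, h3u⟩ := sqrt_three_bounds
  have hcl : (-0.8661 : ℝ) < cθ 1 := by unfold cθ; linarith
  have hcu : cθ 1 < (-0.866 : ℝ) := by unfold cθ; linarith
  have hsl : (0.4998 : ℝ) < sqrt (1 - cθ 1 ^ 2) := by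
    rw [lt_sqrt (by norm_num)]; nlinarith
  unfold g
  nlinarith

/-- `g_2 ≤ 1.293467231945` (certified bracket; `g_2/(12 − 2) < g₁₁`). [cite: BezdekReid2013, proof of Theorem 1 (i) (per-ball exposed-area / contact-deficit summation; here with the Lévy cap table at probing radius 2)] -/
theorem g_two_le : g 2 ≤ 1.293467231945 := by
  obtain ⟨h3l, h3u⟩ := sqrt_three_bounds
  have hcl : (-0.7321 : ℝ) < cθ 2 := by unfold cθ; linarith
  have hcu : cθ 2 < (-0.732 : ℝ) := by unfold cθ; linarith
  have hsl : (0.6811 : ℝ) < sqrt (1 - cθ 2 ^ 2) := by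
    rw [lt_sqrt (by norm_num)]; nlinarith
  unfold g
  nlinarith

/-- `g_3 ≤ 1.117269821645` (certified bracket; `g_3/(12 − 3) < g₁₁`). [cite: BezdekReid2013, proof of Theorem 1 (i) (per-ball exposed-area / contact-deficit summation; here with the Lévy cap table at probing radius 2)] -/
theorem g_three_le : g 3 ≤ 1.117269821645 := by
  obtain ⟨h3l, h3u⟩ := sqrt_three_bounds
  have hcl : (-0.5981 : ℝ) < cθ 3 := by unfold cθ; linarith
  have hcu : cθ 3 < (-0.598 : ℝ) := by unfold cθ; linarith
  have hsl : (0.8014 : ℝ) < sqrt (1 - cθ 3 ^ 2) := by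
    rw [lt_sqrt (by norm_num)]; nlinarith
  unfold g
  nlinarith

/-- `g_4 ≤ 0.95915901389` (certified bracket; `g_4/(12 − 4) < g₁₁`). [cite: BezdekReid2013, proof of Theorem 1 (i) (per-ball exposed-area / contact-deficit summation; here with the Lévy cap table at probing radius 2)] -/
theorem g_four_le : g 4 ≤ 0.95915901389 := by
  obtain ⟨h3l, h3u⟩ := sqrt_three_bounds
  have hcl : (-0.4642 : ℝ) < cθ 4 := by unfold cθ; linarith
  have hcu : cθ 4 < (-0.4641 : ℝ) := by unfold cθ; linarith
  have hsl : (0.8857 : ℝ) < sqrt (1 - cθ 4 ^ 2) := by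
    rw [lt_sqrt (by norm_num)]; nlinarith
  unfold g
  nlinarith

/-- `g_5 ≤ 0.81401160359` (certified bracket; `g_5/(12 − 5) < g₁₁`). [cite: BezdekReid2013, proof of Theorem 1 (i) (per-ball exposed-area / contact-deficit summation; here with the Lévy cap table at probing radius 2)] -/
theorem g_five_le : g 5 ≤ 0.81401160359 := by
  obtain ⟨h3l, h3u⟩ := sqrt_three_bounds
  have hcl : (-0.3302 : ℝ) < cθ 5 := by unfold cθ; linarith
  have hcu : cθ 5 < (-0.3301 : ℝ) := by unfold cθ; linarith
  have hsl : (0.9439 : ℝ) < sqrt (1 - cθ 5 ^ 2) := by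
    rw [lt_sqrt (by norm_num)]; nlinarith
  unfold g
  nlinarith

/-- `g_6 ≤ 0.67966419329` (certified bracket; `g_6/(12 − 6) < g₁₁`). [cite: BezdekReid2013, proof of Theorem 1 (i) (per-ball exposed-area / contact-deficit summation; here with the Lévy cap table at probing radius 2)] -/
theorem g_six_le : g 6 ≤ 0.67966419329 := by
  obtain ⟨h3l, h3u⟩ := sqrt_three_bounds
  have hcl : (-0.1962 : ℝ) < cθ 6 := by unfold cθ; linarith
  have hcu : cθ 6 < (-0.1961 : ℝ) := by unfold cθ; linarith
  have hsl : (0.9805 : ℝ) < sqrt (1 - cθ 6 ^ 2) := by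
    rw [lt_sqrt (by norm_num)]; nlinarith
  unfold g
  nlinarith

/-- `g_7 ≤ 0.55486678299` (certified bracket; `g_7/(12 − 7) < g₁₁`). [cite: BezdekReid2013, proof of Theorem 1 (i) (per-ball exposed-area / contact-deficit summation; here with the Lévy cap table at probing radius 2)] -/
theorem g_seven_le : g 7 ≤ 0.55486678299 := by
  obtain ⟨h3l, h3u⟩ := sqrt_three_bounds
  have hcl : (-0.0622 : ℝ) < cθ 7 := by unfold cθ; linarith
  have hcu : cθ 7 < (-0.0621 : ℝ) := by unfold cθ; linarith
  have hsl : (0.998 : ℝ) < sqrt (1 - cθ 7 ^ 2) := by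
    rw [lt_sqrt (by norm_num)]; nlinarith
  unfold g
  nlinarith

/-- `g_8 ≤ 0.43920597882` (certified bracket; `g_8/(12 − 8) < g₁₁`). [cite: BezdekReid2013, proof of Theorem 1 (i) (per-ball exposed-area / contact-deficit summation; here with the Lévy cap table at probing radius 2)] -/
theorem g_eight_le : g 8 ≤ 0.43920597882 := by
  obtain ⟨h3l, h3u⟩ := sqrt_three_bounds
  have hcl : (0.0717 : ℝ) < cθ 8 := by unfold cθ; linarith
  have hcu : cθ 8 < (0.0718 : ℝ) := by unfold cθ; linarith
  have hsl : (0.9974 : ℝ) < sqrt (1 - cθ 8 ^ 2) := by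
    rw [lt_sqrt (by norm_num)]; nlinarith
  unfold g
  nlinarith

/-- `g_9 ≤ 0.33260857522` (certified bracket; `g_9/(12 − 9) < g₁₁`). [cite: BezdekReid2013, proof of Theorem 1 (i) (per-ball exposed-area / contact-deficit summation; here with the Lévy cap table at probing radius 2)] -/
theorem g_nine_le : g 9 ≤ 0.33260857522 := by
  obtain ⟨h3l, h3u⟩ := sqrt_three_bounds
  have hcl : (0.2057 : ℝ) < cθ 9 := by unfold cθ; linarith
  have hcu : cθ 9 < (0.2058 : ℝ) := by unfold cθ; linarith
  have hsl : (0.9785 : ℝ) < sqrt (1 - cθ 9 ^ 2) := by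
    rw [lt_sqrt (by norm_num)]; nlinarith
  unfold g
  nlinarith

/-- `g_10 ≤ 0.23561117162` (certified bracket; `g_10/(12 − 10) < g₁₁`). [cite: BezdekReid2013, proof of Theorem 1 (i) (per-ball exposed-area / contact-deficit summation; here with the Lévy cap table at probing radius 2)] -/
theorem g_ten_le : g 10 ≤ 0.23561117162 := by
  obtain ⟨h3l, h3u⟩ := sqrt_three_bounds
  have hcl : (0.3397 : ℝ) < cθ 10 := by unfold cθ; linarith
  have hcu : cθ 10 < (0.3398 : ℝ) := by unfold cθ; linarith
  have hsl : (0.9404 : ℝ) < sqrt (1 - cθ 10 ^ 2) := by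
    rw [lt_sqrt (by norm_num)]; nlinarith
  unfold g
  nlinarith

/-- **The binding type is `k = 11`**: `g_k ≤ (12 − k) g₁₁` for `1 ≤ k ≤ 11`. [cite: BezdekReid2013, proof of Theorem 1 (i) (per-ball exposed-area / contact-deficit summation; here with the Lévy cap table at probing radius 2)] -/
theorem g_le_deficit_mul_g_eleven {k : ℕ} (hk1 : 1 ≤ k) (hk11 : k ≤ 11) :
    g k ≤ (12 - (k : ℝ)) * g 11 := by
  have h11 := g_eleven_bounds.1
  interval_cases k
  · have := g_one_le; push_cast; linarith
  · have := g_two_le; push_cast; linarith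
  · have := g_three_le; push_cast; linarith
  · have := g_four_le; push_cast; linarith
  · have := g_five_le; push_cast; linarith
  · have := g_six_le; push_cast; linarith
  · have := g_seven_le; push_cast; linarith
  · have := g_eight_le; push_cast; linarith
  · have := g_nine_le; push_cast; linarith
  · have := g_ten_le; push_cast; linarith
  · push_cast; linarith

/-- `fLevy2 11 = 8π g₁₁ > 0`. [cite: BezdekReid2013, proof of Theorem 1 (i) (per-ball exposed-area / contact-deficit summation; here with the Lévy cap table at probing radius 2)] -/
theorem fLevy2_eleven_pos : 0 < fLevy2 11 := by
  have := g_eleven_bounds.1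
  simp only [fLevy2, show (11:ℕ) ≠ 0 by decide, show ¬ 12 ≤ 11 by decide, if_false]
  positivity

/-- **The LP rows**: `fLevy2 m ≤ fLevy2 11 · (12 − m)` for `1 ≤ m ≤ 11`. [cite: BezdekReid2013, proof of Theorem 1 (i) (per-ball exposed-area / contact-deficit summation; here with the Lévy cap table at probing radius 2)] -/
theorem fLevy2_le (m : ℕ) (hm1 : 1 ≤ m) (hm11 : m ≤ 11) : fLevy2 m ≤ fLevy2 11 * (12 - (m : ℝ)) := by
  have hπ : 0 < π := pi_pos
  have h := g_le_deficit_mul_g_eleven hm1 hm11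
  have hm0 : m ≠ 0 := by omega
  have hm12 : ¬ 12 ≤ m := by omega
  simp only [fLevy2, hm0, hm12, show (11:ℕ) ≠ 0 by decide, show ¬ 12 ≤ 11 by decide, if_false]
  nlinarith

/-- **The constant**: `γ = 2π / fLevy2 11 = 1/(4 g₁₁) > 1.6732`. [cite: BezdekReid2013, proof of Theorem 1 (i) (per-ball exposed-area / contact-deficit summation; here with the Lévy cap table at probing radius 2)] -/
theorem gamma_gt : (1.6732 : ℝ) < 2 * π / fLevy2 11 := by
  have hπ : 0 < π := pi_pos
  obtain ⟨h1, h2⟩ := g_eleven_bounds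
  have hf : fLevy2 11 = 8 * π * g 11 := by simp [fLevy2]
  rw [hf, lt_div_iff₀ (by positivity)]
  nlinarith

/-! ### 4. The assembled bound (Theorem A skeleton of DECOMPOSITION.md §5) -/

end Literature.Geometry.DiscreteGeometry.ContactNumber.Inequalities

end Part5

/-!
## Part 6 — port of `Summits/Ventures/Crystal3D/LocalLP/SurfaceComposition.lean` (10 declarations kept)

# The surface bound from named geometric inputs: composition of the whole chain

This file
is the top of the "local inequalities + LP certificate ⇒ theorem" chain for the contact number of
unit sphere packings in `ℝ³`. It DEFINES the exposed directions of a ball and their normalised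
area, STATES the three packing-level geometric inputs as named propositions (hypotheses — NOT
proved here, NOT asserted), and PROVES that together with a certified per-type table, the
vertex-removal induction (`LocalLP/Induction.lean`) and base cases they imply the surface bound
`C(x) < 6N - γ N^{2/3}` for every packing of every `N ≥ 2` balls (the unfolded form of
`Statement.SurfaceBound γ`). The trust base of any instance is therefore exactly: the three named
inputs (each a consequence of published theorems — Lévy–Schmidt spherical isoperimetry, the
isoperimetric inequality of `ℝ³` with a cell/density bound, and kissing saturation — whose
derivations are the `Inequalities/` files and Literature facts), plus kernel-checked
arithmetic. No crystallization statement is claimed.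

## Definitions (diameter-`1` balls, contact at distance `1`; probing radius `r`, e.g. `r = 1`
## is Bezdek–Reid's radius-`2` sphere around radius-`1` balls)

* `exposedCap x r i` — the EXPOSED DIRECTIONS of ball `i`: unit vectors `u` such that the point
  `x i + r • u` of the probing sphere lies in no OPEN ball of radius `r` about another centre
  (`r ≤ dist (x i + r • u) (x j)` for all `j ≠ i`), i.e. the part of the sphere `S(x i, r)` on the
  boundary of the union `⋃ B(x j, r)`.
* `exposedFraction x r i ∈ [0, 1]` — its normalised area: the unit-ball volume fraction of the
  cone it spans (`Literature.Geometry.DiscreteGeometry.ballFraction`, Hales DSP §3.2), i.e. solid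
  angle `/ 4π`. This is literally `sphereFraction (exposedCap x r i)` of the tree's
  `Literature/Geometry/DiscreteGeometry/SphericalIsoperimetric.lean` (same `rayCone` body), so the
  Lévy–Schmidt fact typed there applies verbatim; no surface-measure normalisation enters.

## Named inputs (hypotheses of the composition; proved/cited separately)

* `LevyCapInput r F` — for every packing and every ball with `k ≤ 11` contacts,
  `exposedFraction ≤ F k` (Bezdek–Reid's cap-covering step sharpened by Lévy–Schmidt: the `k`
  contact directions carry disjoint caps, and the neighbourhood of their union is at least that
  of a cap of the same area; `F` is the resulting explicit table, in sphere fractions).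
* `SaturationInput r` — a ball with `12` contacts has no exposed directions of positive measure
  at radius `r` (kissing saturation; Hales 2012 / Bezdek–Reid Thm 4 for `r` below the `2.52/2`
  gap).
* `IsoInput r s` — for every packing of `N` balls, `∑ᵢ exposedFraction ≥ s · N^{2/3}`
  (isoperimetric inequality for the union of the `r`-balls + a volume lower bound `N · v` for it:
  `s = (36π)^{1/3} v^{2/3} / (4π r²)`).

## Proved

* `surfaceLP_of_inputs` — the LP step on a packing all of whose balls have `> k₀` contacts:
  `C(x) ≤ 6N - (s / 2ρ) N^{2/3}` whenever `F k ≤ ρ (12 - k)` for `k₀ < k ≤ 11` (via the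
  summation lemma `Inequalities.contacts_le_of_exposed`).
* `surfaceBound_of_inputs` — THE COMPOSITION: inputs + table + `γ < s / 2ρ` + base cases
  (`2 ≤ N ≤ N₁`) + the step condition (`N ≥ N₁`) ⇒ `∀ N ≥ 2, ∀ packing, C < 6N - γ N^{2/3}`.
* Base-case helpers: `rpow_two_thirds_le_of_sq_le_cube` (`t² ≤ q³ ⇒ t^{2/3} ≤ q`) and
  `base_case_of_choose_two` (`N(N-1)/2 < 6N - γ q`, `N^{2/3} ≤ q` ⇒ the bound at `N`), so that a
  finite base table is discharged by `norm_num`.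

References: K. Bezdek, S. Reid, J. Geom. 104 (2013) 57–83, §2; T. Figiel, J. Lindenstrauss,
V. D. Milman, Acta Math. 139 (1977), Thm 2.1 (Lévy–Schmidt); H. Federer, *Geometric Measure
Theory* (1969) 3.2.43; T. C. Hales, *Dense Sphere Packings* (2012) §3.2 (solid angle as volume
fraction).
-/

section Part6

open scoped _root_.BigOperators
open _root_.Finset

namespace Literature.Geometry.DiscreteGeometry.ContactNumber

open Literature.Geometry.DiscreteGeometry (ballFraction ballFraction_nonneg ballFraction_le_one)
open Literature.Geometry.DiscreteGeometry.ContactNumber.Inequalities (contacts_le_of_exposed)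

variable {N : ℕ}

/-! ## Exposed directions and their normalised area -/

/-- The **exposed directions** of ball `i` at probing radius `r`: unit vectors `u` for which the
point `x i + r • u` lies in no open ball of radius `r` about another centre.
[cite: BezdekReid2013, proof of Theorem 1 (i) (exposed directions, the three packing-level inputs, composition to C < 6N − γN^{2/3})] -/
def exposedCap (x : Fin N → EuclideanSpace ℝ (Fin 3)) (r : ℝ) (i : Fin N) :
    Set (EuclideanSpace ℝ (Fin 3)) :=
  {u | ‖u‖ = 1 ∧ ∀ j, j ≠ i → r ≤ dist (x i + r • u) (x j)}

/-- The **exposed fraction** of ball `i` at radius `r`: the normalised area (solid angle `/ 4π`)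
of its exposed directions, as the unit-ball volume fraction of the cone of non-zero vectors whose
direction is exposed (`ballFraction`; equal by `rfl` to `sphereFraction (exposedCap x r i)` of
`Literature/Geometry/DiscreteGeometry/SphericalIsoperimetric.lean`).
[cite: BezdekReid2013, proof of Theorem 1 (i) (exposed directions, the three packing-level inputs, composition to C < 6N − γN^{2/3})] -/
def exposedFraction (x : Fin N → EuclideanSpace ℝ (Fin 3)) (r : ℝ) (i : Fin N) : ℝ :=
  ballFraction (0 : EuclideanSpace ℝ (Fin 3)) {v | v ≠ 0 ∧ ‖v‖⁻¹ • v ∈ exposedCap x r i}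

/-- An exposed fraction is non-negative.
[cite: BezdekReid2013, proof of Theorem 1 (i) (exposed directions, the three packing-level inputs, composition to C < 6N − γN^{2/3})] -/
theorem exposedFraction_nonneg (x : Fin N → EuclideanSpace ℝ (Fin 3)) (r : ℝ) (i : Fin N) :
    0 ≤ exposedFraction x r i :=
  ballFraction_nonneg _ _

/-- **Input (L), cap covering / Lévy–Schmidt**: in every packing of diameter-`1` balls in `ℝ³`,
a ball with `k ≤ 11` contacts has exposed fraction at radius `r` at most `F k`. (The table `F`
is explicit — e.g. `F k = 2 g_k = fLevy2 k / 4π` of `Inequalities/ExposedAreaDeficit.lean` at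
`r = 1` — and is what the Lévy–Schmidt inequality with `k` disjoint contact caps yields; this
Prop is the packing-level STATEMENT, a hypothesis here.)
[cite: BezdekReid2013, proof of Theorem 1 (i) (exposed directions, the three packing-level inputs, composition to C < 6N − γN^{2/3})] -/
def LevyCapInput (r : ℝ) (F : ℕ → ℝ) : Prop :=
  ∀ (N : ℕ) (x : Fin N → EuclideanSpace ℝ (Fin 3)), IsUnitPacking x → ∀ i : Fin N,
    coordination x i ≤ 11 → exposedFraction x r i ≤ F (coordination x i)

/-- **Input (K), kissing saturation**: in every packing, a ball with `12` contacts has exposed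
fraction `0` at radius `r` (every direction of its `r`-sphere is within `r` of one of the twelve
neighbours; Hales 2012 / Bezdek–Reid Thm 4 for `r` below half the `2.52` gap). A hypothesis
here.
[cite: BezdekReid2013, proof of Theorem 1 (i) (exposed directions, the three packing-level inputs, composition to C < 6N − γN^{2/3})] -/
def SaturationInput (r : ℝ) : Prop :=
  ∀ (N : ℕ) (x : Fin N → EuclideanSpace ℝ (Fin 3)), IsUnitPacking x → ∀ i : Fin N,
    coordination x i = 12 → exposedFraction x r i = 0

/-- **Input (I), isoperimetry**: in every packing of `N` diameter-`1` balls in `ℝ³` the exposed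
fractions at radius `r` sum to at least `s · N^{2/3}` (isoperimetric inequality for the union of
the `r`-balls, whose volume is at least `N` times a cell volume; `s` collects the constants).
A hypothesis here.
[cite: BezdekReid2013, proof of Theorem 1 (i) (exposed directions, the three packing-level inputs, composition to C < 6N − γN^{2/3})] -/
def IsoInput (r s : ℝ) : Prop :=
  ∀ (N : ℕ) (x : Fin N → EuclideanSpace ℝ (Fin 3)), IsUnitPacking x →
    s * (N : ℝ) ^ ((2 : ℝ) / 3) ≤ ∑ i, exposedFraction x r i

/-! ## The LP step on reduced packings -/

/-- **LP step.** Under the three inputs and a table bound `F k ≤ ρ (12 - k)` for `k₀ < k ≤ 11`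
(`ρ > 0`), every packing all of whose balls have more than `k₀` contacts satisfies
`C(x) ≤ 6N - (s / 2ρ) · N^{2/3}` — the summation lemma `contacts_le_of_exposed` applied
with `e i = exposedFraction x r i`, `k i = coordination x i`.
[cite: BezdekReid2013, proof of Theorem 1 (i) (exposed directions, the three packing-level inputs, composition to C < 6N − γN^{2/3})] -/
theorem surfaceLP_of_inputs {r s ρ : ℝ} {F : ℕ → ℝ} {k₀ : ℕ} (hcap : LevyCapInput r F)
    (hsat : SaturationInput r) (hiso : IsoInput r s) (hρ : 0 < ρ)
    (hF : ∀ k : ℕ, k₀ < k → k ≤ 11 → F k ≤ ρ * (12 - (k : ℝ)))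
    {N : ℕ} (x : Fin N → EuclideanSpace ℝ (Fin 3)) (hx : IsUnitPacking x)
    (hk₀ : ∀ i, k₀ < coordination x i) :
    (numContacts x : ℝ) ≤ 6 * N - s / (2 * ρ) * (N : ℝ) ^ ((2 : ℝ) / 3) := by
  classical
  -- the effective table: `0` at `12` and below `k₀` (no such balls occur)
  set f : ℕ → ℝ := fun m => if m = 12 then 0 else if k₀ < m then F m else 0 with hf
  have h := contacts_le_of_exposed (C := numContacts x) (fun i => coordination x i)
    (fun i => exposedFraction x r i) f (ρ := ρ) (S := s * (N : ℝ) ^ ((2 : ℝ) / 3)) hρ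
    (fun i => Nat.succ_le_of_lt (lt_of_le_of_lt (Nat.zero_le _) (hk₀ i)))
    (fun i => coordination_le_twelve hx i)
    (by simp [hf])
    (by
      intro m hm1 hm11
      have hm12 : m ≠ 12 := by omega
      have hρm : 0 ≤ ρ * (12 - (m : ℝ)) := by
        have : (m : ℝ) ≤ 11 := by exact_mod_cast hm11
        nlinarith
      by_cases hkm : k₀ < m
      · simp only [hf, hm12, if_false, hkm, if_true]; exact hF m hkm hm11
      · simp only [hf, hm12, if_false, hkm]; exact hρm)
    (by
      intro i
      by_cases h12 : coordination x i = 12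
      · simp only [hf, h12, if_true]; exact (hsat N x hx i h12).le
      · have h11 : coordination x i ≤ 11 := by
          have := coordination_le_twelve hx i; omega
        simp only [hf, h12, if_false, hk₀ i, if_true]
        exact hcap N x hx i h11)
    (hiso N x hx)
    (sum_coordination_eq x).symm
  have hrew : s * (N : ℝ) ^ ((2 : ℝ) / 3) / (2 * ρ) = s / (2 * ρ) * (N : ℝ) ^ ((2 : ℝ) / 3) := by
    ring
  rw [hrew] at h
  exact h

/-! ## Base-case helpers -/

/-- `t² ≤ q³` (with `t, q ≥ 0`) gives `t^{2/3} ≤ q` — rational certificates for `N^{2/3}`.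
[cite: BezdekReid2013, proof of Theorem 1 (i) (exposed directions, the three packing-level inputs, composition to C < 6N − γN^{2/3})] -/
theorem rpow_two_thirds_le_of_sq_le_cube {t q : ℝ} (ht : 0 ≤ t) (hq : 0 ≤ q)
    (h : t ^ 2 ≤ q ^ 3) : t ^ ((2 : ℝ) / 3) ≤ q := by
  have h1 : t ^ ((2 : ℝ) / 3) = (t ^ 2) ^ ((1 : ℝ) / 3) := by
    rw [← Real.rpow_natCast, ← Real.rpow_mul ht]; norm_num
  have h2 : q = (q ^ 3) ^ ((1 : ℝ) / 3) := by
    rw [← Real.rpow_natCast, ← Real.rpow_mul hq]; norm_num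
  rw [h1, h2]
  exact Real.rpow_le_rpow (by positivity) h (by norm_num)

/-- **Base case from the trivial bound**: if `N^{2/3} ≤ q` and `N(N-1)/2 < 6N - γ q` with
`γ ≥ 0`, then every configuration of `N` balls has `C < 6N - γ N^{2/3}`.
[cite: BezdekReid2013, proof of Theorem 1 (i) (exposed directions, the three packing-level inputs, composition to C < 6N − γN^{2/3})] -/
theorem base_case_of_choose_two {γ q : ℝ} {N : ℕ} (hγ : 0 ≤ γ)
    (hq : (N : ℝ) ^ ((2 : ℝ) / 3) ≤ q) (h : (N : ℝ) * ((N : ℝ) - 1) / 2 < 6 * N - γ * q)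
    (x : Fin N → EuclideanSpace ℝ (Fin 3)) :
    (numContacts x : ℝ) < 6 * N - γ * (N : ℝ) ^ ((2 : ℝ) / 3) := by
  have h1 := numContacts_le_choose_two x
  have h2 : γ * (N : ℝ) ^ ((2 : ℝ) / 3) ≤ γ * q := mul_le_mul_of_nonneg_left hq hγ
  linarith

/-! ## The composition -/

/-- **Surface bound from the named inputs.** Let `(L)`, `(K)`, `(I)` hold at radius `r` with
table `F` and constant `s`; let `ρ > 0` dominate the table (`F k ≤ ρ(12 - k)` for
`k₀ < k ≤ 11`) and `0 ≤ γ < s / 2ρ`; let the bound hold for `2 ≤ N ≤ N₁` (base cases, `N₁ ≥ 2`)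
and let `γ ((N+1)^{2/3} - N^{2/3}) ≤ 6 - k₀` for `N ≥ N₁` (step condition; see
`step_of_threshold`). Then EVERY packing of every `N ≥ 2` diameter-`1` balls in `ℝ³` satisfies
`C(x) < 6N - γ N^{2/3}`.
[cite: BezdekReid2013, proof of Theorem 1 (i) (exposed directions, the three packing-level inputs, composition to C < 6N − γN^{2/3})] -/
theorem surfaceBound_of_inputs {r s ρ γ : ℝ} {F : ℕ → ℝ} {k₀ N₁ : ℕ}
    (hcap : LevyCapInput r F) (hsat : SaturationInput r) (hiso : IsoInput r s) (hρ : 0 < ρ)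
    (hF : ∀ k : ℕ, k₀ < k → k ≤ 11 → F k ≤ ρ * (12 - (k : ℝ))) (hγ : γ < s / (2 * ρ))
    (hN₁ : 2 ≤ N₁)
    (hbase : ∀ N : ℕ, 2 ≤ N → N ≤ N₁ → ∀ x : Fin N → EuclideanSpace ℝ (Fin 3),
      IsUnitPacking x → (numContacts x : ℝ) < 6 * N - γ * (N : ℝ) ^ ((2 : ℝ) / 3))
    (hstep : ∀ N : ℕ, N₁ ≤ N →
      γ * (((N : ℝ) + 1) ^ ((2 : ℝ) / 3) - (N : ℝ) ^ ((2 : ℝ) / 3)) ≤ 6 - (k₀ : ℝ)) :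
    ∀ N : ℕ, 2 ≤ N → ∀ x : Fin N → EuclideanSpace ℝ (Fin 3), IsUnitPacking x →
      (numContacts x : ℝ) < 6 * N - γ * (N : ℝ) ^ ((2 : ℝ) / 3) := by
  refine surfaceBound_of_reduction hN₁ hbase hstep ?_
  intro N hN x hx hk₀
  have hLP := surfaceLP_of_inputs hcap hsat hiso hρ hF x hx hk₀
  have hNpos : (0 : ℝ) < N := by exact_mod_cast (lt_of_lt_of_le (by omega : 0 < N₁) hN.le)
  have hpow : 0 < (N : ℝ) ^ ((2 : ℝ) / 3) := Real.rpow_pos_of_pos hNpos _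
  have hγ' : γ * (N : ℝ) ^ ((2 : ℝ) / 3) < s / (2 * ρ) * (N : ℝ) ^ ((2 : ℝ) / 3) :=
    mul_lt_mul_of_pos_right hγ hpow
  linarith

end Literature.Geometry.DiscreteGeometry.ContactNumber

end Part6

/-!
## Part 7 — port of `Summits/Ventures/Crystal3D/LocalLP/LevyCap.lean` (20 declarations kept)

# The cap input `(L)` at probing radius `1` from the Lévy–Schmidt inequality

This file
DERIVES the named input `LevyCapInput 1 F` of `LocalLP/SurfaceComposition.lean`, with the pure
Lévy table `F k = fLevy2 k / 16π` (`Inequalities.fLevy2`), from ONE named fact of the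
Literature: `Literature.Geometry.DiscreteGeometry.Schmidt1948_sphericalIsoperimetric` (the
Lévy–Schmidt spherical isoperimetric inequality in the form of Figiel–Lindenstrauss–Milman 1977,
Thm 2.1; PROVED in the tree, `SphericalIsoperimetricProof.lean`). Everything else is proved here: the exposed directions of a ball
with `k` contacts lie in the closed set `W` of directions at angle `≥ π/3` from the `k` contact
directions; the contact directions are pairwise at angle `≥ π/3`, so the closed caps of any
radius `ρ < π/6` about them are pairwise disjoint and disjoint from the `π/6`-neighbourhood of `W`
(triangle inequality for angles); additivity of the cone volume fraction over finitely many
disjoint measurable direction sets gives `σ(W_{π/6}) + k σ(cap ρ) ≤ 1`, hence (letting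
`ρ → π/6`) `σ(W_{π/6}) ≤ 1 - k(1 - √3/2)/2`; Lévy–Schmidt bounds `σ(W_{π/6})` below by the cap of
radius `r + π/6` where `σ(W) = σ(cap r)`; the real-analysis step `cap(r + π/6) ≤ … ⇒ σ(W) ≤
fLevy2 k / 16π` is `exposed_le_fLevy2`. No crystallization statement is claimed.
-/

section Part7

open scoped _root_.BigOperators RealInnerProductSpace _root_.Topology
open _root_.Finset _root_.Real InnerProductGeometry _root_.MeasureTheory _root_.Set _root_.Filter

namespace Literature.Geometry.DiscreteGeometry.ContactNumber

open Literature.Geometry.DiscreteGeometry (ballFraction sphereFraction sphCap sphNhd rayCone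
  Schmidt1948_sphericalIsoperimetric sphereFraction_sphCap sphereFraction_mono
  sphereFraction_le_one sphereFraction_nonneg sphereFraction_sphere sphCap_of_pi_le rayCone_sphCap)
open Literature.Geometry.DiscreteGeometry.ContactNumber.Inequalities (cθ fLevy2 exposed_le_fLevy2 sqrt_three_bounds)

variable {N : ℕ} {x : Fin N → EuclideanSpace ℝ (Fin 3)}

/-! ## A. Elementary spherical geometry of unit vectors -/

/-- For unit vectors, `‖a - b‖ ≥ 1` gives `⟪a, b⟫ ≤ 1/2`.
[cite: FigielLindenstraussMilman1977, Thm. 2.1 (Lévy–Schmidt spherical isoperimetric inequality ⇒ the cap input at probing radius 1)] -/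
theorem inner_le_half_of_one_le_norm_sub {a b : EuclideanSpace ℝ (Fin 3)} (ha : ‖a‖ = 1)
    (hb : ‖b‖ = 1) (h : 1 ≤ ‖a - b‖) : ⟪a, b⟫ ≤ 1 / 2 := by
  have h1 : 1 ≤ ‖a - b‖ ^ 2 := by nlinarith [norm_nonneg (a - b)]
  rw [norm_sub_sq_real, ha, hb] at h1
  linarith

/-- For unit vectors, `⟪a, b⟫ ≤ 1/2` gives angle `≥ π/3`.
[cite: FigielLindenstraussMilman1977, Thm. 2.1 (Lévy–Schmidt spherical isoperimetric inequality ⇒ the cap input at probing radius 1)] -/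
theorem pi_div_three_le_angle {a b : EuclideanSpace ℝ (Fin 3)} (ha : ‖a‖ = 1) (hb : ‖b‖ = 1)
    (h : ⟪a, b⟫ ≤ 1 / 2) : π / 3 ≤ angle a b := by
  have hcos : cos (angle a b) ≤ cos (π / 3) := by
    rw [cos_angle, ha, hb, mul_one, div_one, cos_pi_div_three]; exact h
  by_contra hlt
  have hlt' : angle a b < π / 3 := not_le.1 hlt
  exact absurd hcos (not_le.2 (Real.cos_lt_cos_of_nonneg_of_le_pi (angle_nonneg a b)
    (by linarith [pi_pos]) hlt'))

/-! ## B. Contact directions and the uncovered set `W` -/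

/-- A contact neighbour gives a unit contact direction `x j - x i`.
[cite: FigielLindenstraussMilman1977, Thm. 2.1 (Lévy–Schmidt spherical isoperimetric inequality ⇒ the cap input at probing radius 1)] -/
theorem norm_contactDir {i j : Fin N} (hj : j ∈ contactNeighbors x i) : ‖x j - x i‖ = 1 := by
  rw [← dist_eq_norm, dist_comm]; exact ((mem_contactNeighbors x).1 hj).2

/-- Distinct contact directions of a packing are at angle `≥ π/3`.
[cite: FigielLindenstraussMilman1977, Thm. 2.1 (Lévy–Schmidt spherical isoperimetric inequality ⇒ the cap input at probing radius 1)] -/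
theorem angle_contactDir_ge (hx : IsUnitPacking x) {i j l : Fin N} (hj : j ∈ contactNeighbors x i)
    (hl : l ∈ contactNeighbors x i) (hjl : j ≠ l) : π / 3 ≤ angle (x j - x i) (x l - x i) := by
  refine pi_div_three_le_angle (norm_contactDir hj) (norm_contactDir hl)
    (inner_le_half_of_one_le_norm_sub (norm_contactDir hj) (norm_contactDir hl) ?_)
  rw [sub_sub_sub_cancel_right, ← dist_eq_norm]
  exact hx hjl

/-- The **uncovered directions** of ball `i`: unit vectors at angle `≥ π/3` (inner product
`≤ 1/2`) from every contact direction — a closed subset of the sphere containing the exposed cap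
at radius `1`.
[cite: FigielLindenstraussMilman1977, Thm. 2.1 (Lévy–Schmidt spherical isoperimetric inequality ⇒ the cap input at probing radius 1)] -/
def uncoveredDir (x : Fin N → EuclideanSpace ℝ (Fin 3)) (i : Fin N) :
    Set (EuclideanSpace ℝ (Fin 3)) :=
  {u | ‖u‖ = 1 ∧ ∀ j ∈ contactNeighbors x i, ⟪u, x j - x i⟫ ≤ 1 / 2}

/-- The exposed cap at radius `1` lies in the uncovered set.
[cite: FigielLindenstraussMilman1977, Thm. 2.1 (Lévy–Schmidt spherical isoperimetric inequality ⇒ the cap input at probing radius 1)] -/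
theorem exposedCap_one_subset_uncoveredDir (i : Fin N) : exposedCap x 1 i ⊆ uncoveredDir x i := by
  rintro u ⟨hu, hfar⟩
  refine ⟨hu, fun j hj => ?_⟩
  have hji : j ≠ i := ((mem_contactNeighbors x).1 hj).1
  have h1 := hfar j hji
  rw [one_smul, dist_eq_norm] at h1
  have : x i + u - x j = u - (x j - x i) := by abel
  rw [this] at h1
  exact inner_le_half_of_one_le_norm_sub hu (norm_contactDir hj) h1

/-- The uncovered set is closed.
[cite: FigielLindenstraussMilman1977, Thm. 2.1 (Lévy–Schmidt spherical isoperimetric inequality ⇒ the cap input at probing radius 1)] -/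
theorem isClosed_uncoveredDir (i : Fin N) : IsClosed (uncoveredDir x i) := by
  have h1 : IsClosed {u : EuclideanSpace ℝ (Fin 3) | ‖u‖ = 1} :=
    isClosed_eq continuous_norm continuous_const
  have h2 : ∀ j : Fin N, IsClosed {u : EuclideanSpace ℝ (Fin 3) | ⟪u, x j - x i⟫ ≤ 1 / 2} :=
    fun j => isClosed_le (continuous_id.inner continuous_const) continuous_const
  have : uncoveredDir x i = {u | ‖u‖ = 1} ∩ ⋂ j ∈ contactNeighbors x i, {u | ⟪u, x j - x i⟫ ≤ 1 / 2} := by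
    ext u; simp [uncoveredDir, mem_iInter]
  rw [this]
  exact h1.inter (isClosed_biInter fun j _ => h2 j)

/-- The uncovered set lies on the unit sphere.
[cite: FigielLindenstraussMilman1977, Thm. 2.1 (Lévy–Schmidt spherical isoperimetric inequality ⇒ the cap input at probing radius 1)] -/
theorem uncoveredDir_subset_sphere (i : Fin N) :
    uncoveredDir x i ⊆ {u : EuclideanSpace ℝ (Fin 3) | ‖u‖ = 1} :=
  fun _ hu => hu.1

/-- Points of the `π/6`-neighbourhood of the uncovered set are at angle `≥ π/6` from every
contact direction (triangle inequality).
[cite: FigielLindenstraussMilman1977, Thm. 2.1 (Lévy–Schmidt spherical isoperimetric inequality ⇒ the cap input at probing radius 1)] -/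
theorem angle_ge_of_mem_sphNhd {i : Fin N} {y : EuclideanSpace ℝ (Fin 3)}
    (hy : y ∈ sphNhd (uncoveredDir x i) (π / 6)) {j : Fin N} (hj : j ∈ contactNeighbors x i) :
    π / 6 ≤ angle (x j - x i) y := by
  obtain ⟨hy1, w, hw, hyw⟩ := hy
  have h60 : π / 3 ≤ angle w (x j - x i) :=
    pi_div_three_le_angle hw.1 (norm_contactDir hj) (hw.2 j hj)
  have htri : angle (x j - x i) w ≤ angle (x j - x i) y + angle y w :=
    angle_le_angle_add_angle _ _ _
  rw [angle_comm] at h60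
  linarith

/-- For `ρ < π/6`, the closed `ρ`-caps about the contact directions miss the neighbourhood.
[cite: FigielLindenstraussMilman1977, Thm. 2.1 (Lévy–Schmidt spherical isoperimetric inequality ⇒ the cap input at probing radius 1)] -/
theorem disjoint_sphNhd_sphCap {i : Fin N} {ρ : ℝ} (hρ : ρ < π / 6) {j : Fin N}
    (hj : j ∈ contactNeighbors x i) :
    Disjoint (sphNhd (uncoveredDir x i) (π / 6)) (sphCap (x j - x i) ρ) := by
  rw [Set.disjoint_left]
  intro y hy hcap
  have := angle_ge_of_mem_sphNhd hy hj
  have h2 : angle (x j - x i) y ≤ ρ := hcap.2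
  linarith

/-- For `ρ < π/6`, the closed `ρ`-caps about distinct contact directions are disjoint.
[cite: FigielLindenstraussMilman1977, Thm. 2.1 (Lévy–Schmidt spherical isoperimetric inequality ⇒ the cap input at probing radius 1)] -/
theorem disjoint_sphCap_sphCap (hx : IsUnitPacking x) {i : Fin N} {ρ : ℝ} (hρ : ρ < π / 6)
    {j l : Fin N} (hj : j ∈ contactNeighbors x i) (hl : l ∈ contactNeighbors x i) (hjl : j ≠ l) :
    Disjoint (sphCap (x j - x i) ρ) (sphCap (x l - x i) ρ) := by
  rw [Set.disjoint_left]
  intro y hyj hyl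
  have h60 := angle_contactDir_ge hx hj hl hjl
  have htri : angle (x j - x i) (x l - x i) ≤ angle (x j - x i) y + angle y (x l - x i) :=
    angle_le_angle_add_angle _ _ _
  have h1 : angle (x j - x i) y ≤ ρ := hyj.2
  have h2 : angle (x l - x i) y ≤ ρ := hyl.2
  rw [angle_comm] at h2
  linarith

/-! ## C. Additivity of the sphere fraction over disjoint measurable direction sets -/

/-- Disjoint direction sets have disjoint ray cones.
[cite: FigielLindenstraussMilman1977, Thm. 2.1 (Lévy–Schmidt spherical isoperimetric inequality ⇒ the cap input at probing radius 1)] -/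
theorem disjoint_rayCone {A B : Set (EuclideanSpace ℝ (Fin 3))} (h : Disjoint A B) :
    Disjoint (rayCone A) (rayCone B) := by
  rw [Set.disjoint_left] at h ⊢
  intro v hvA hvB
  exact h hvA.2 hvB.2

/-- The ray cone of a closed cap about a unit vector is measurable.
[cite: FigielLindenstraussMilman1977, Thm. 2.1 (Lévy–Schmidt spherical isoperimetric inequality ⇒ the cap input at probing radius 1)] -/
theorem measurableSet_rayCone_sphCap {a : EuclideanSpace ℝ (Fin 3)} (ha : ‖a‖ = 1) {ρ : ℝ}
    (hρ0 : 0 ≤ ρ) (hρπ : ρ ≤ π) : MeasurableSet (rayCone (sphCap a ρ)) := by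
  rw [rayCone_sphCap ha hρ0 hρπ]
  have h1 : IsOpen {v : EuclideanSpace ℝ (Fin 3) | v ≠ 0} := isOpen_ne
  have h2 : IsClosed {v : EuclideanSpace ℝ (Fin 3) | cos ρ * ‖v‖ ≤ ⟪a, v⟫} :=
    isClosed_le (continuous_const.mul continuous_norm) (continuous_const.inner continuous_id)
  have : {v : EuclideanSpace ℝ (Fin 3) | v ≠ 0 ∧ cos ρ * ‖v‖ ≤ ⟪a, v⟫} =
      {v | v ≠ 0} ∩ {v | cos ρ * ‖v‖ ≤ ⟪a, v⟫} := rfl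
  rw [this]
  exact h1.measurableSet.inter h2.measurableSet

/-- **Additivity bound.** For a direction set `A` and finitely many direction sets `C j`
(`j ∈ s`) with measurable ray cones, pairwise disjoint and disjoint from `A`:
`σ(A) + ∑ σ(C j) ≤ 1`.
[cite: FigielLindenstraussMilman1977, Thm. 2.1 (Lévy–Schmidt spherical isoperimetric inequality ⇒ the cap input at probing radius 1)] -/
theorem sphereFraction_add_sum_le_one {ι : Type*} (s : Finset ι)
    (A : Set (EuclideanSpace ℝ (Fin 3))) (C : ι → Set (EuclideanSpace ℝ (Fin 3)))
    (hmeas : ∀ j ∈ s, MeasurableSet (rayCone (C j)))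
    (hdisj : ∀ j ∈ s, ∀ l ∈ s, j ≠ l → Disjoint (C j) (C l))
    (hA : ∀ j ∈ s, Disjoint A (C j)) :
    sphereFraction A + ∑ j ∈ s, sphereFraction (C j) ≤ 1 := by
  classical
  set B : Set (EuclideanSpace ℝ (Fin 3)) := Metric.ball 0 1 with hB
  have hVtop : volume B ≠ ⊤ := measure_ball_lt_top.ne
  have hVpos : 0 < (volume B).toReal :=
    ENNReal.toReal_pos (Metric.measure_ball_pos volume (0 : EuclideanSpace ℝ (Fin 3)) one_pos).ne' hVtop
  -- the pieces inside the ball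
  set P : ι → Set (EuclideanSpace ℝ (Fin 3)) := fun j => B ∩ rayCone (C j) with hP
  have hPmeas : ∀ j ∈ s, MeasurableSet (P j) :=
    fun j hj => measurableSet_ball.inter (hmeas j hj)
  have hPdisj : (↑s : Set ι).PairwiseDisjoint P := by
    intro j hj l hl hjl
    exact Disjoint.mono Set.inter_subset_right Set.inter_subset_right
      (disjoint_rayCone (hdisj j hj l hl hjl))
  have hU : volume (⋃ j ∈ s, P j) = ∑ j ∈ s, volume (P j) := measure_biUnion_finset hPdisj hPmeas
  have hAU : Disjoint (B ∩ rayCone A) (⋃ j ∈ s, P j) := by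
    rw [Set.disjoint_iUnion_right]; intro j
    rw [Set.disjoint_iUnion_right]; intro hj
    exact Disjoint.mono Set.inter_subset_right Set.inter_subset_right (disjoint_rayCone (hA j hj))
  have hUmeas : MeasurableSet (⋃ j ∈ s, P j) := MeasurableSet.biUnion s.countable_toSet hPmeas
  have htot : volume (B ∩ rayCone A) + ∑ j ∈ s, volume (P j) ≤ volume B := by
    rw [← hU, ← measure_union hAU hUmeas]
    exact measure_mono (union_subset Set.inter_subset_left
      (iUnion₂_subset fun j _ => Set.inter_subset_left))
  -- pass to real numbers
  have hfinA : volume (B ∩ rayCone A) ≠ ⊤ :=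
    ((measure_mono Set.inter_subset_left).trans_lt measure_ball_lt_top).ne
  have hfinP : ∀ j ∈ s, volume (P j) ≠ ⊤ := fun j _ =>
    ((measure_mono Set.inter_subset_left).trans_lt measure_ball_lt_top).ne
  have hreal : (volume (B ∩ rayCone A)).toReal + ∑ j ∈ s, (volume (P j)).toReal ≤
      (volume B).toReal := by
    rw [← ENNReal.toReal_sum hfinP, ← ENNReal.toReal_add hfinA (ENNReal.sum_ne_top.2 hfinP)]
    exact ENNReal.toReal_mono hVtop htot
  -- divide by `vol B`
  have hfracA : sphereFraction A = (volume (B ∩ rayCone A)).toReal / (volume B).toReal := rfl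
  have hfracC : ∀ j, sphereFraction (C j) = (volume (P j)).toReal / (volume B).toReal := fun j => rfl
  rw [hfracA]
  simp_rw [hfracC]
  rw [← Finset.sum_div, ← add_div, div_le_one hVpos]
  exact hreal

/-! ## D. The neighbourhood bound `σ(W_{π/6}) ≤ 1 - k (1 - √3/2)/2` -/

/-- For every `0 ≤ ρ < π/6`: `σ(W_{π/6}) + k · (1 - cos ρ)/2 ≤ 1`.
[cite: FigielLindenstraussMilman1977, Thm. 2.1 (Lévy–Schmidt spherical isoperimetric inequality ⇒ the cap input at probing radius 1)] -/
theorem sphNhd_add_caps_le_one (hx : IsUnitPacking x) (i : Fin N) {ρ : ℝ} (hρ0 : 0 ≤ ρ)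
    (hρ : ρ < π / 6) :
    sphereFraction (sphNhd (uncoveredDir x i) (π / 6)) +
      (coordination x i : ℝ) * ((1 - cos ρ) / 2) ≤ 1 := by
  have hρπ : ρ ≤ π := by linarith [pi_pos]
  have h := sphereFraction_add_sum_le_one (contactNeighbors x i)
    (sphNhd (uncoveredDir x i) (π / 6)) (fun j => sphCap (x j - x i) ρ)
    (fun j hj => measurableSet_rayCone_sphCap (norm_contactDir hj) hρ0 hρπ)
    (fun j hj l hl hjl => disjoint_sphCap_sphCap hx hρ hj hl hjl)
    (fun j hj => disjoint_sphNhd_sphCap hρ hj)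
  have hcaps : ∑ j ∈ contactNeighbors x i, sphereFraction (sphCap (x j - x i) ρ) =
      (coordination x i : ℝ) * ((1 - cos ρ) / 2) := by
    rw [Finset.sum_congr rfl fun j hj => sphereFraction_sphCap (norm_contactDir hj) hρ0 hρπ,
      Finset.sum_const, nsmul_eq_mul, coordination]
  rw [hcaps] at h
  exact h

/-- **Neighbourhood bound**: `σ(W_{π/6}) ≤ 1 - k · (1 - √3/2)/2` (`k` = coordination number),
by letting `ρ → π/6` in the previous lemma.
[cite: FigielLindenstraussMilman1977, Thm. 2.1 (Lévy–Schmidt spherical isoperimetric inequality ⇒ the cap input at probing radius 1)] -/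
theorem sphereFraction_sphNhd_le (hx : IsUnitPacking x) (i : Fin N) :
    sphereFraction (sphNhd (uncoveredDir x i) (π / 6)) ≤
      1 - (coordination x i : ℝ) * ((1 - Real.sqrt 3 / 2) / 2) := by
  set σ := sphereFraction (sphNhd (uncoveredDir x i) (π / 6)) with hσ
  set k : ℝ := (coordination x i : ℝ) with hk
  -- the continuous function `ρ ↦ σ + k (1 - cos ρ)/2` is `≤ 1` on `[0, π/6)`, hence at `π/6`
  have hcont : Continuous fun ρ : ℝ => σ + k * ((1 - cos ρ) / 2) :=
    continuous_const.add (continuous_const.mul ((continuous_const.sub continuous_cos).div_const _))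
  have hlim : Tendsto (fun ρ : ℝ => σ + k * ((1 - cos ρ) / 2)) (𝓝[<] (π / 6))
      (𝓝 (σ + k * ((1 - cos (π / 6)) / 2))) :=
    (hcont.tendsto (π / 6)).mono_left nhdsWithin_le_nhds
  have hev : ∀ᶠ ρ in 𝓝[<] (π / 6), σ + k * ((1 - cos ρ) / 2) ≤ 1 := by
    have hpos : (0 : ℝ) < π / 6 := by positivity
    have hmem : Set.Ioo (0 : ℝ) (π / 6) ∈ 𝓝[<] (π / 6) := Ioo_mem_nhdsLT hpos
    filter_upwards [hmem] with ρ hρ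
    exact sphNhd_add_caps_le_one hx i hρ.1.le hρ.2
  have hle := le_of_tendsto hlim hev
  rw [cos_pi_div_six] at hle
  linarith

/-! ## E. The Lévy step and the table -/

/-- `cθ k ∈ [-1, 1]` for `k ≤ 11` (needed to invert the cosine).
[cite: FigielLindenstraussMilman1977, Thm. 2.1 (Lévy–Schmidt spherical isoperimetric inequality ⇒ the cap input at probing radius 1)] -/
theorem abs_cθ_le_one {k : ℕ} (hk : k ≤ 11) : -1 ≤ cθ k ∧ cθ k ≤ 1 := by
  obtain ⟨h1, h2⟩ := sqrt_three_bounds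
  have hk' : (k : ℝ) ≤ 11 := by exact_mod_cast hk
  have hk0 : (0 : ℝ) ≤ k := Nat.cast_nonneg k
  constructor
  · unfold cθ; nlinarith
  · unfold cθ; nlinarith

/-- `fLevy2 k ≥ 0` for `1 ≤ k ≤ 11`: `g_k = 1 - (√3/2) c - (1/2)√(1 - c²) ≥ 0` by Cauchy–Schwarz
(`((√3/2) c + (1/2) s)² + ((1/2) c - (√3/2) s)² = c² + s² = 1`).
[cite: FigielLindenstraussMilman1977, Thm. 2.1 (Lévy–Schmidt spherical isoperimetric inequality ⇒ the cap input at probing radius 1)] -/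
theorem fLevy2_nonneg {k : ℕ} (hk1 : 1 ≤ k) (hk11 : k ≤ 11) : 0 ≤ fLevy2 k := by
  have hπ : 0 < π := pi_pos
  unfold fLevy2
  have hk0 : k ≠ 0 := by omega
  have hk12 : ¬ 12 ≤ k := by omega
  simp only [hk0, hk12, if_false]
  obtain ⟨hc1, hc2⟩ := abs_cθ_le_one hk11
  set c := cθ k with hc
  set sn := Real.sqrt (1 - c ^ 2) with hsn
  have hsq : sn ^ 2 = 1 - c ^ 2 := Real.sq_sqrt (by nlinarith)
  have h3 : Real.sqrt 3 ^ 2 = 3 := Real.sq_sqrt (by norm_num)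
  have ht : (Real.sqrt 3 / 2 * c + 1 / 2 * sn) ^ 2 ≤ 1 := by
    nlinarith [sq_nonneg (1 / 2 * c - Real.sqrt 3 / 2 * sn)]
  have ht1 : Real.sqrt 3 / 2 * c + 1 / 2 * sn ≤ 1 :=
    (abs_le.1 ((sq_le_one_iff_abs_le_one _).1 ht)).2
  have hg : 0 ≤ Inequalities.g k := by
    unfold Inequalities.g
    rw [← hc, ← hsn]
    linarith
  positivity

/-- **The Lévy bound on the uncovered set**: under the Lévy–Schmidt fact, a ball with
`1 ≤ k ≤ 11` contacts has `σ(W) ≤ fLevy2 k / 16π`.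
[cite: FigielLindenstraussMilman1977, Thm. 2.1 (Lévy–Schmidt spherical isoperimetric inequality ⇒ the cap input at probing radius 1)] -/
theorem sphereFraction_uncoveredDir_le (hLevy : Schmidt1948_sphericalIsoperimetric)
    (hx : IsUnitPacking x) (i : Fin N) (hk1 : 1 ≤ coordination x i)
    (hk11 : coordination x i ≤ 11) :
    sphereFraction (uncoveredDir x i) ≤ fLevy2 (coordination x i) / (16 * π) := by
  set W := uncoveredDir x i with hW
  set k := coordination x i with hk
  have hπ : 0 < π := pi_pos
  by_cases hne : W.Nonempty
  swap
  · -- empty uncovered set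
    rw [Set.not_nonempty_iff_eq_empty] at hne
    have h0 : sphereFraction W = 0 := by
      rw [hne]
      have : rayCone (∅ : Set (EuclideanSpace ℝ (Fin 3))) = ∅ := by
        ext v; simp [rayCone]
      simp [sphereFraction, this, ballFraction]
    rw [h0]
    have hf : 0 ≤ fLevy2 k := fLevy2_nonneg hk1 hk11
    positivity
  · -- nonempty: choose the cap radius `r` with `σ(W) = σ(cap r)`
    set a₀ := sphereFraction W with ha₀
    have ha₀0 : 0 ≤ a₀ := sphereFraction_nonneg W
    have ha₀1 : a₀ ≤ 1 := sphereFraction_le_one W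
    set r := Real.arccos (1 - 2 * a₀) with hr
    have hr0 : 0 ≤ r := Real.arccos_nonneg _
    have hrπ : r ≤ π := Real.arccos_le_pi _
    have hcosr : cos r = 1 - 2 * a₀ := by
      rw [hr]; exact Real.cos_arccos (by linarith) (by linarith)
    -- a fixed pole
    set e₀ : EuclideanSpace ℝ (Fin 3) := EuclideanSpace.single 0 1 with he₀
    have he₀n : ‖e₀‖ = 1 := by simp [he₀]
    have hcap : sphereFraction W = sphereFraction (sphCap e₀ r) := by
      rw [sphereFraction_sphCap he₀n hr0 hrπ, hcosr]; ring
    -- Lévy–Schmidt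
    have hL := hLevy W e₀ r (π / 6) hne (isClosed_uncoveredDir i) (uncoveredDir_subset_sphere i)
      he₀n hr0 (by positivity) hcap
    have hNbhd := sphereFraction_sphNhd_le hx i
    rw [← hk] at hNbhd
    -- the big cap cannot be the whole sphere (k ≥ 1)
    have hsmall : r + π / 6 ≤ π := by
      by_contra hbig
      have hbig' : π ≤ r + π / 6 := (not_le.1 hbig).le
      have h1 : sphereFraction (sphCap e₀ (r + π / 6)) = 1 := by
        rw [sphCap_of_pi_le e₀ hbig', sphereFraction_sphere]
      rw [h1] at hL
      obtain ⟨hs1, hs2⟩ := sqrt_three_bounds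
      have hk1' : (1 : ℝ) ≤ k := by exact_mod_cast hk1
      have : (0 : ℝ) < k * ((1 - Real.sqrt 3 / 2) / 2) := by
        apply mul_pos (by linarith); nlinarith
      linarith
    have hcapBig : sphereFraction (sphCap e₀ (r + π / 6)) = (1 - cos (r + π / 6)) / 2 :=
      sphereFraction_sphCap he₀n (by positivity) hsmall
    rw [hcapBig] at hL
    -- `harea` in normalisation (areas on the radius-2 sphere, total `16π`… their
    -- lemma is stated with `2π(1 - cos)` caps on the unit sphere times `4`)
    have harea : 2 * π * (1 - cos (r + π / 6)) ≤ 4 * π - k * (2 * π * (1 - Real.sqrt 3 / 2)) := by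
      have := hL.trans hNbhd
      nlinarith [hπ]
    -- invert the cosine of `θ_k`
    obtain ⟨hc1, hc2⟩ := abs_cθ_le_one hk11
    set θ := Real.arccos (cθ k) with hθ
    have hθ0 : 0 ≤ θ := Real.arccos_nonneg _
    have hθπ : θ ≤ π := Real.arccos_le_pi _
    have hcθ : cos θ = cθ k := by rw [hθ]; exact Real.cos_arccos hc1 hc2
    have hmain := exposed_le_fLevy2 hk1 hk11 hθ0 hθπ hcθ hr0 hsmall harea
    -- `4 · 2π(1 - cos r) ≤ fLevy2 k` and `a₀ = (1 - cos r)/2`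
    have ha : a₀ = (1 - cos r) / 2 := by rw [hcosr]; ring
    rw [ha, le_div_iff₀ (by positivity)]
    nlinarith [hmain, hπ]

/-- **`(L)` at radius `1` from Lévy–Schmidt.** Under the named fact
`Schmidt1948_sphericalIsoperimetric`, every ball with `k ≤ 11` contacts in a packing of
diameter-`1` balls has exposed fraction at probing radius `1` at most `fLevy2 k / 16π`
(the pure Lévy table: `1` at `k = 0`, `g_k / 2` for `1 ≤ k ≤ 11`).
[cite: FigielLindenstraussMilman1977, Thm. 2.1 (Lévy–Schmidt spherical isoperimetric inequality ⇒ the cap input at probing radius 1)] -/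
theorem levyCapInput_one (hLevy : Schmidt1948_sphericalIsoperimetric) :
    LevyCapInput 1 (fun k => fLevy2 k / (16 * π)) := by
  intro N x hx i hk11
  change sphereFraction (exposedCap x 1 i) ≤ fLevy2 (coordination x i) / (16 * π)
  rcases Nat.eq_zero_or_pos (coordination x i) with h0 | hpos
  · -- no contacts: the bound is `16π / 16π = 1`
    rw [h0]
    have : fLevy2 0 / (16 * π) = 1 := by
      rw [show fLevy2 0 = 16 * π by simp [fLevy2]]
      exact div_self (by positivity)
    rw [this]
    exact sphereFraction_le_one _
  · exact (sphereFraction_mono (exposedCap_one_subset_uncoveredDir i)).trans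
      (sphereFraction_uncoveredDir_le hLevy hx i hpos hk11)

end Literature.Geometry.DiscreteGeometry.ContactNumber

end Part7

/-!
## Part 8 — port of `Summits/Ventures/Crystal3D/LocalLP/Saturation.lean` (3 declarations kept)

# Kissing saturation at probing radius `1` is a theorem: `SaturationInput 1`

This file
DISCHARGES, unconditionally, the named input `(K)` of `LocalLP/SurfaceComposition.lean` at
probing radius `1` (= Bezdek's radius-`2` sphere around radius-`1` balls): a ball with twelve
contacts has NO exposed direction at radius `1` — its exposed cap is empty, so its exposed
fraction is `0`. Proof: an exposed direction `u` gives the point `x i + u` at distance `1` from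
`x i` and at distance `≥ 1` from the twelve contact neighbours, i.e. thirteen unit vectors
(`u` and the `x j - x i`) pairwise at distance `≥ 1`, contradicting the tree's kissing-number
theorem `musin2006_kissing_three_holds`. Consequently the headline `H1` needs only the inputs
`(L)` and `(I)`. (At smaller probing radii, e.g. H2's `1783/2000`, saturation needs Hales's
twelve-neighbour gap `2.52` and stays an input.) No crystallization statement is claimed.
-/

section Part8

open scoped _root_.BigOperators
open _root_.Finset

namespace Literature.Geometry.DiscreteGeometry.ContactNumber

open Literature.Geometry.DiscreteGeometry (musin2006_kissing_three_holds ballFraction)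

variable {N : ℕ} {x : Fin N → EuclideanSpace ℝ (Fin 3)}

/-- **Twelve contacts leave no exposed direction at radius `1`.**
[cite: Musin2006, Theorem (kissing number 12 ⇒ a twelve-contact ball has no exposed direction at radius 1)] -/
theorem exposedCap_one_eq_empty (hx : IsUnitPacking x) (i : Fin N) (h12 : coordination x i = 12) :
    exposedCap x 1 i = ∅ := by
  classical
  ext u
  simp only [exposedCap, one_smul, Set.mem_setOf_eq, Set.mem_empty_iff_false, iff_false, not_and]
  intro hu hfar
  -- the twelve contact directions
  set S : Finset (EuclideanSpace ℝ (Fin 3)) := (contactNeighbors x i).image fun j => x j - x i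
    with hS
  have hinj : Set.InjOn (fun j => x j - x i) ↑(contactNeighbors x i) :=
    fun j _ k _ h => hx.injective (sub_left_injective h)
  have hScard : S.card = 12 := by
    rw [hS, card_image_of_injOn hinj]; exact h12
  -- `u` is not one of them (it is far from every other centre)
  have huS : u ∉ S := by
    intro h
    obtain ⟨j, hj, hju⟩ := mem_image.1 h
    have hji : j ≠ i := ((mem_contactNeighbors x).1 hj).1
    have h1 := hfar j hji
    rw [← hju, add_sub_cancel, dist_self] at h1
    exact absurd h1 (by norm_num)
  have hT : (insert u S).card = 13 := by
    rw [card_insert_of_notMem huS, hScard]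
  -- thirteen unit vectors pairwise at distance ≥ 1: impossible
  have h13 := musin2006_kissing_three_holds (insert u S) ?_ ?_
  · omega
  · intro v hv
    rcases mem_insert.1 hv with rfl | hv
    · exact hu
    · obtain ⟨j, hj, rfl⟩ := mem_image.1 hv
      rw [← dist_eq_norm, dist_comm]
      exact ((mem_contactNeighbors x).1 hj).2
  · -- pairwise separation
    have key : ∀ v ∈ S, 1 ≤ dist u v := by
      intro v hv
      obtain ⟨j, hj, rfl⟩ := mem_image.1 hv
      have hji : j ≠ i := ((mem_contactNeighbors x).1 hj).1
      have h1 := hfar j hji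
      have : dist u (x j - x i) = dist (x i + u) (x j) := by
        rw [dist_eq_norm, dist_eq_norm]
        congr 1
        abel
      rw [this]; exact h1
    intro v hv w hw hvw
    rcases mem_insert.1 hv with hv' | hv'
    · rcases mem_insert.1 hw with hw' | hw'
      · exact absurd (hv'.trans hw'.symm) hvw
      · rw [hv']; exact key w hw'
    · rcases mem_insert.1 hw with hw' | hw'
      · rw [hw', dist_comm]; exact key v hv'
      · obtain ⟨j, hj, rfl⟩ := mem_image.1 hv'
        obtain ⟨k, hk, rfl⟩ := mem_image.1 hw'
        have hjk : j ≠ k := fun h => hvw (by rw [h])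
        rw [dist_eq_norm, sub_sub_sub_cancel_right, ← dist_eq_norm]
        exact hx hjk

/-- An empty set of directions has exposed fraction `0` (volume fraction of the empty cone).
[cite: Musin2006, Theorem (kissing number 12 ⇒ a twelve-contact ball has no exposed direction at radius 1)] -/
theorem ballFraction_rayCone_empty :
    ballFraction (0 : EuclideanSpace ℝ (Fin 3))
      {v : EuclideanSpace ℝ (Fin 3) | v ≠ 0 ∧ ‖v‖⁻¹ • v ∈ (∅ : Set (EuclideanSpace ℝ (Fin 3)))}
      = 0 := by
  simp [ballFraction]

/-- **`(K)` at radius `1` is a theorem**: in every packing of diameter-`1` balls in `ℝ³`, a ball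
with twelve contacts has exposed fraction `0` at probing radius `1` (kissing number twelve).
[cite: Musin2006, Theorem (kissing number 12 ⇒ a twelve-contact ball has no exposed direction at radius 1)] -/
theorem saturationInput_one : SaturationInput 1 := by
  intro N x hx i h12
  unfold exposedFraction
  rw [exposedCap_one_eq_empty hx i h12]
  exact ballFraction_rayCone_empty

end Literature.Geometry.DiscreteGeometry.ContactNumber

end Part8

/-!
## Part 9 — port of `Summits/Ventures/Crystal3D/LocalLP/LevyHeadline.lean` (1 declarations kept)

# The rung `6N - 1.67 N^{2/3}` from the Lévy–Schmidt inequality and the isoperimetric input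

`surfaceBound_levy` — `Schmidt1948_sphericalIsoperimetric → IsoInput 1 (1/4) → ∀ N ≥ 2, ∀ packing of N diameter-1 balls in ℝ³,
C < 6N - (167/100) N^{2/3}`: the pure-Lévy rung (`γ = 1.67 < 2π / fLevy2 11 = 1.6732…`, binding type `k = 11`, no vertex removal
needed beyond isolated balls), with `(L)` supplied by `levyCapInput_one` and `(K)` by `saturationInput_one`.  Both hypotheses are tree
theorems; the unconditional form and Bezdek–Reid's printed `0.926` follow in the last Part.  (The source module's second theorem,
Bezdek's Conjecture 3.5 in covering form, is not re-homed here.)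
-/

section Part9

open scoped _root_.BigOperators RealInnerProductSpace _root_.Topology
open _root_.Finset _root_.Real InnerProductGeometry _root_.MeasureTheory _root_.Set _root_.Filter

namespace Literature.Geometry.DiscreteGeometry.ContactNumber

open Literature.Geometry.DiscreteGeometry (ballFraction sphereFraction sphCap rayCone
  Schmidt1948_sphericalIsoperimetric sphereFraction_mono sphereFraction_le_one
  sphereFraction_nonneg sphereFraction_sphere musin2006_kissing_three_holds)
open Literature.Geometry.DiscreteGeometry.ContactNumber.Inequalities (cθ g fLevy2 fLevy2_le fLevy2_eleven_pos gamma_gt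
  g_le_deficit_mul_g_eleven g_eleven_bounds)

/-! ## The pure-Lévy rung of the surface bound -/

/-- **`C < 6N - 1.67 N^{2/3}` from Lévy–Schmidt and the isoperimetric input.**
[cite: BezdekReid2013, Theorem 1 (i) (here the stronger 6N − 1.67 N^{2/3} from Lévy–Schmidt and the isoperimetric input)] -/
theorem surfaceBound_levy (hLevy : Schmidt1948_sphericalIsoperimetric) (hI : IsoInput 1 (1 / 4)) :
    ∀ N : ℕ, 2 ≤ N → ∀ x : Fin N → EuclideanSpace ℝ (Fin 3), IsUnitPacking x →
      (numContacts x : ℝ) < 6 * N - (167 / 100 : ℝ) * (N : ℝ) ^ ((2 : ℝ) / 3) := by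
  have hπ : 0 < π := pi_pos
  have hf11 := fLevy2_eleven_pos
  refine surfaceBound_of_inputs (ρ := fLevy2 11 / (16 * π)) (k₀ := 0) (N₁ := 2)
    (levyCapInput_one hLevy) saturationInput_one hI (by positivity) ?table ?gamma le_rfl
    ?base ?step
  case table =>
    intro k hk hk11
    rw [div_mul_eq_mul_div]
    exact div_le_div_of_nonneg_right (fLevy2_le k (by omega) hk11) (by positivity)
  case gamma =>
    have h : (1 / 4 : ℝ) / (2 * (fLevy2 11 / (16 * π))) = 2 * π / fLevy2 11 := by
      field_simp; ring
    rw [h]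
    linarith [gamma_gt]
  case base =>
    intro N hN2 hN2' x _
    have hN : N = 2 := le_antisymm hN2' hN2
    subst hN
    exact base_case_of_choose_two (q := 8 / 5) (by norm_num)
      (rpow_two_thirds_le_of_sq_le_cube (by norm_num) (by norm_num) (by norm_num))
      (by norm_num) x
  case step =>
    refine step_of_threshold (by norm_num) (by norm_num) ?_
    have h2 : (1 : ℝ) ≤ (2 : ℝ) ^ ((1 : ℝ) / 3) :=
      Real.one_le_rpow (by norm_num) (by norm_num)
    push_cast
    linarith

/-! ## Bezdek's Conjecture 3.5, covering form -/

variable {M : ℕ}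

end Literature.Geometry.DiscreteGeometry.ContactNumber

end Part9

/-!
## Part 10 — port of `Summits/Ventures/Crystal3D/LocalLP/IsoFederer.lean` (2 declarations kept)

# The isoperimetric input `(I)` from Federer's inequality

`isoInput_of_federer` / `isoInput_one_of_federer`: the named input `IsoInput r (1/(4r²))` of Part `SurfaceComposition` (for every
probing radius `r ≥ 1/2`; at `r = 1`, `IsoInput 1 (1/4)`) from the isoperimetric inequality for finite unions of balls in `ℝ³`
(`Literature.Geometry.DiscreteGeometry.Federer1969_isoperimetricUnionBalls`, a tree THEOREM: `IsoperimetricUnionBallsProof.lean`)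
via `ExposedSurfaceIsoperimetric.lean`.  The unconditional assembly is the last Part.
-/

section Part10

open scoped _root_.BigOperators
open _root_.Real _root_.Finset

namespace Literature.Geometry.DiscreteGeometry.ContactNumber

open Literature.Geometry.DiscreteGeometry (sphereFraction exposedDirections
  Federer1969_isoperimetricUnionBalls Schmidt1948_sphericalIsoperimetric sphereFraction_nonneg
  Schmidt1948_sphericalIsoperimetric_holds)

variable {N : ℕ}

/-- **`(I)` from Federer.** Under Federer's isoperimetric inequality for unions of balls, every
packing of `N` diameter-`1` balls in `ℝ³` has total exposed fraction at probing radius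
`r ≥ 1/2` at least `N^{2/3} / (4 r²)` (the `N` disjoint balls of radius `1/2` give
`vol ≥ N π/6`, so `area ≥ (36π)^{1/3} (Nπ/6)^{2/3} = π N^{2/3}`, a fraction `1/(4r²)` of the
probing sphere's `4π r²` per `N^{2/3}`).
[cite: Federer1969, 3.2.43 (isoperimetric inequality for finite unions of balls ⇒ the input (I))] -/
theorem isoInput_of_federer (h : Federer1969_isoperimetricUnionBalls) {r : ℝ} (hr : 1 / 2 ≤ r) :
    IsoInput r (1 / (4 * r ^ 2)) := by
  intro N x hx
  have hr0 : 0 < r := lt_of_lt_of_le (by norm_num) hr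
  have hπ : 0 < π := pi_pos
  -- Federer's corollary with `ρ = 1/2`
  have hsep : Pairwise fun i j => 2 * (1 / 2 : ℝ) ≤ dist (x i) (x j) := by
    intro i j hij; have := hx hij; linarith
  have hF := Federer1969_isoperimetricUnionBalls.sphereFraction_sum_cube h x (by norm_num) hr hsep
  simp only [Fintype.card_fin] at hF
  -- rewrite the sum in the venture's vocabulary
  have hS : ∑ i, sphereFraction (exposedDirections x r i) = ∑ i, exposedFraction x r i := rfl
  rw [hS] at hF
  set S := ∑ i, exposedFraction x r i with hSdef
  have hS0 : 0 ≤ S := Finset.sum_nonneg fun i _ => exposedFraction_nonneg x r i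
  set T := 4 * π * r ^ 2 * S with hT
  have hT0 : 0 ≤ T := by positivity
  -- `T³ ≥ π³ N²`, hence `T ≥ π N^{2/3}`
  have hcube : (π * (N : ℝ) ^ ((2 : ℝ) / 3)) ^ 3 ≤ T ^ 3 := by
    have hN23 : ((N : ℝ) ^ ((2 : ℝ) / 3)) ^ 3 = (N : ℝ) ^ 2 := by
      rw [← Real.rpow_natCast, ← Real.rpow_mul (Nat.cast_nonneg N)]; norm_num
    calc (π * (N : ℝ) ^ ((2 : ℝ) / 3)) ^ 3 = π ^ 3 * (N : ℝ) ^ 2 := by rw [mul_pow, hN23]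
      _ = 36 * π * ((N : ℝ) * (4 / 3 * π * (1 / 2 : ℝ) ^ 3)) ^ 2 := by ring
      _ ≤ T ^ 3 := hF
  have hTge : π * (N : ℝ) ^ ((2 : ℝ) / 3) ≤ T := by
    by_contra hlt
    have hlt' : T < π * (N : ℝ) ^ ((2 : ℝ) / 3) := not_le.1 hlt
    have : T ^ 3 < (π * (N : ℝ) ^ ((2 : ℝ) / 3)) ^ 3 :=
      pow_lt_pow_left₀ hlt' hT0 (by norm_num)
    linarith
  -- divide by `4π r²`
  have h4 : 0 < 4 * π * r ^ 2 := by positivity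
  calc 1 / (4 * r ^ 2) * (N : ℝ) ^ ((2 : ℝ) / 3) = (π * (N : ℝ) ^ ((2 : ℝ) / 3)) / (4 * π * r ^ 2) := by
        field_simp
    _ ≤ T / (4 * π * r ^ 2) := div_le_div_of_nonneg_right hTge h4.le
    _ = S := by rw [hT]; field_simp

/-- At probing radius `1`: `IsoInput 1 (1/4)` from Federer's inequality.
[cite: Federer1969, 3.2.43 (isoperimetric inequality for finite unions of balls ⇒ the input (I))] -/
theorem isoInput_one_of_federer (h : Federer1969_isoperimetricUnionBalls) : IsoInput 1 (1 / 4) := by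
  have := isoInput_of_federer h (r := 1) (by norm_num)
  simpa using this

end Literature.Geometry.DiscreteGeometry.ContactNumber

end Part10

/-! ## Part 11 — the unconditional Lévy rung and the EXACT discharge `BezdekReid2013_contactNumber_lt_holds` -/

namespace Literature.Geometry.DiscreteGeometry

/-- **The Lévy rung, unconditionally: `C(x) < 6N − 1.67 N^{2/3}`** for every packing `x` of `N ≥ 2` balls of DIAMETER `1`
in `ℝ³` — `ContactNumber.surfaceBound_levy` fed with the tree's theorems `Schmidt1948_sphericalIsoperimetric_holds`
(Lévy–Schmidt, `SphericalIsoperimetricProof.lean`) and `Federer1969_isoperimetricUnionBalls_holds`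
(`IsoperimetricUnionBallsProof.lean`, through `ContactNumber.isoInput_one_of_federer`).  Stronger than Bezdek–Reid's printed
constant `0.926` (by the Lévy route, not by the printed dodecahedral route).
[cite: BezdekReid2013, Theorem 1 (i)] [cite: FigielLindenstraussMilman1977, Thm. 2.1] -/
theorem ContactNumber.numContacts_lt_levy {N : ℕ} (hN : 2 ≤ N) (x : Fin N → EuclideanSpace ℝ (Fin 3))
    (hx : ContactNumber.IsUnitPacking x) :
    (ContactNumber.numContacts x : ℝ) < 6 * N - (167 / 100 : ℝ) * (N : ℝ) ^ ((2 : ℝ) / 3) :=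
  ContactNumber.surfaceBound_levy Schmidt1948_sphericalIsoperimetric_holds
    (ContactNumber.isoInput_one_of_federer Federer1969_isoperimetricUnionBalls_holds) N hN x hx

/-- **The named fact `BezdekReid2013_contactNumber_lt` HOLDS** (`ContactNumberBounds.lean`; Bezdek–Reid, J. Geom. 104 (2013),
Theorem 1 (i): every packing of `n ≥ 2` unit balls in `ℝ³` has fewer than `6n − 0.926 n^{2/3}` touching pairs) — from the
`1.67` rung (`ContactNumber.numContacts_lt_levy`) through the radius-one scaling bridge `x ↦ x/2`
(`ContactNumber.isUnitPacking_iff_two_smul`, `ContactNumber.numContacts_eq_contactNumber_two_smul`) and `0.926 ≤ 1.67`.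
EXACT discharge; the only previous proof was the Summits-side
`Summit.Ventures.Crystal3D.bezdekReid2013_contactNumber_lt_holds` (same route). [cite: BezdekReid2013, Theorem 1 (i)] -/
theorem BezdekReid2013_contactNumber_lt_holds : BezdekReid2013_contactNumber_lt := by
  intro n x hn hinj hP
  set y : Fin n → EuclideanSpace ℝ (Fin 3) := fun i => (1 / 2 : ℝ) • x i with hy
  have h2y : (fun i => (2 : ℝ) • y i) = x := by
    funext i
    rw [hy, smul_smul]
    norm_num
  have hyP : ContactNumber.IsUnitPacking y := by
    rw [ContactNumber.isUnitPacking_iff_two_smul, h2y]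
    exact ⟨hinj, hP⟩
  have h := ContactNumber.numContacts_lt_levy hn y hyP
  rw [ContactNumber.numContacts_eq_contactNumber_two_smul, h2y] at h
  have hmono : (0.926 : ℝ) * (n : ℝ) ^ ((2 : ℝ) / 3) ≤ 167 / 100 * (n : ℝ) ^ ((2 : ℝ) / 3) :=
    mul_le_mul_of_nonneg_right (by norm_num) (by positivity)
  linarith

end Literature.Geometry.DiscreteGeometry

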